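import Summits.CriticalPhenomena.SAWScalingLimit.Theses.SAWLoopFugacityFlow
import Summits.CriticalPhenomena.SAWScalingLimit.Theorems.IsingBoundaryRatio.Negative.IsingBoundaryRatioNesting
import Summits.CriticalPhenomena.SAWScalingLimit.Theorems.SAWLoopFugacityFlowIsingBoundaryRatioRestrictionMapAtZero
import Summits.CriticalPhenomena.SAWScalingLimit.Theorems.SAWLoopFugacityFlowIsingBoundaryRatioRestrictionMapAtInfty
import Summits.CriticalPhenomena.SAWScalingLimit.Theorems.SAWLoopFugacityFlowIsingBoundaryRatioBoundaryFusion
import Summits.CriticalPhenomena.SAWScalingLimit.Theorems.SAWLoopFugacityFlowIsingBoundaryRatioBulkFreeRatio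
import Summits.CriticalPhenomena.SAWScalingLimit.Theorems.SAWLoopFugacityFlowIsingBoundaryRatioForgettingDefs
import Summits.CriticalPhenomena.SAWScalingLimit.Theorems.SAWLoopFugacityFlowIsingBoundaryRatioChartAnnulusSeparation
import Summits.CriticalPhenomena.SAWScalingLimit.Theorems.SAWLoopFugacityFlowIsingBoundaryRatioReverseDobrushin
import Summits.CriticalPhenomena.SAWScalingLimit.Theorems.SAWLoopFugacityFlowIsingBoundaryRatioArmOriginForgettingFalse
import Summits.CriticalPhenomena.SAWScalingLimit.Theorems.SAWLoopFugacityFlowIsingBoundaryRatioEdwardsSokalFinset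
import Summits.CriticalPhenomena.SAWScalingLimit.Theorems.SAWLoopFugacityFlowIsingBoundaryRatioLocalAgreementTransfer
import Summits.CriticalPhenomena.SAWScalingLimit.Theorems.SAWLoopFugacityFlowIsingBoundaryRatioRSWDefs
import Summits.CriticalPhenomena.SAWScalingLimit.Theorems.SAWLoopFugacityFlowIsingBoundaryRatioRoughHalfAnnulusRSW
import Summits.CriticalPhenomena.SAWScalingLimit.Theorems.SAWLoopFugacityFlowIsingBoundaryRatioRoughHalfAnnulusRSWPath
import Summits.CriticalPhenomena.SAWScalingLimit.Theorems.SAWLoopFugacityFlowIsingBoundaryRatioRSWMeshDefs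
import Summits.CriticalPhenomena.SAWScalingLimit.Theorems.SAWLoopFugacityFlowIsingBoundaryRatioRoughHalfAnnulusRSWMesh
import Summits.CriticalPhenomena.SAWScalingLimit.Theorems.SAWLoopFugacityFlowIsingBoundaryRatioWindowRectDefs
import Summits.CriticalPhenomena.SAWScalingLimit.Theorems.SAWLoopFugacityFlowIsingBoundaryRatioRoughHalfAnnulusRSWLarge
import Summits.CriticalPhenomena.SAWScalingLimit.Theorems.SAWLoopFugacityFlowIsingBoundaryRatioChartDiscOneComponent
import Summits.CriticalPhenomena.SAWScalingLimit.Theorems.SAWLoopFugacityFlowIsingBoundaryRatioWindowExtResistanceBound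
import Summits.CriticalPhenomena.SAWScalingLimit.Theorems.SAWLoopFugacityFlowIsingBoundaryRatioHalfAnnulusSideCrossingBoundOf
import Summits.CriticalPhenomena.SAWScalingLimit.Theorems.SAWLoopFugacityFlowIsingBoundaryRatioAnnCrossThroughWindowRect
import Summits.CriticalPhenomena.SAWScalingLimit.Theorems.SAWLoopFugacityFlowIsingBoundaryRatioHalfAnnulusRimCrossingBoundLargeOf
import Summits.CriticalPhenomena.SAWScalingLimit.Theorems.SAWLoopFugacityFlowIsingBoundaryRatioRadialDefs
import Summits.CriticalPhenomena.SAWScalingLimit.Theorems.SAWLoopFugacityFlowIsingBoundaryRatioRadialCrossingBound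
import Summits.CriticalPhenomena.SAWScalingLimit.Theorems.SAWLoopFugacityFlowIsingBoundaryRatioHeartAssembly
import Summits.CriticalPhenomena.SAWScalingLimit.Theorems.SAWLoopFugacityFlowIsingBoundaryRatioFkArmOriginForgettingBS
import Summits.CriticalPhenomena.SAWScalingLimit.Theorems.SAWLoopFugacityFlowIsingBoundaryRatioWindowRectPresentation
import Literature.Probability.LatticeModels.DiscreteExtremalLengthExternalArcs
import Literature.Probability.LatticeModels.DiscreteExtremalLengthExternalArcsProofs
import Literature.Probability.LatticeModels.DiscreteExtremalLengthExternalArcsSelfDual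
import Literature.Probability.LatticeModels.PlanarIsingOnePointProofs

/-!
# Line `fk-anchor-transfer` — skeleton for the crux `IsingBoundaryRatio`
(stmt-CriticalPhenomena-10650, route `SAWLoopFugacityFlow`, decl
`Summit.CriticalPhenomena.SAWScalingLimit.Theses.SAWLoopFugacityFlow.IsingBoundaryRatio`; crux-plan round 1,
planner `planner-cruxplan-stmt-CriticalPhenomena-10650-fk-anchor-transfer-0`; idea card
`Cruxes/IsingBoundaryRatio/Ideas/fk-anchor-transfer.md`, triage r1: 3 × pass).

MOVE THE ANCHORS INLAND. The crux's ratio `⟨σ_{a_δ}σ_{b_δ}⟩^free_{Ω'_δ} / ⟨σ_{a_δ}σ_{b_δ}⟩^free_{Ω_δ}`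
is compared with the same nested ratio for BULK anchors `[z/δ], [w/δ]`, `z, w ∈ D'` close to `a, b`:

* `stub_anchorLocality` (= `AnchorLocality`; L, OPEN, HARDEST — the lever, ONE marked point at a
  time as the triage asked): the double ratio (anchor `x` vs anchor `x'`, both near `D.pt i`, against
  a far spin `y`; `Ω'` over `Ω`) is eventually within `η` of `1` — the boundary-anchor/bulk-anchor
  ratio is blind to the domain beyond `B(D.pt i, ε)` (Edwards–Sokal + arm-origin forgetting for critical
  FK-Ising at a free ROUGH prime end; value-free, no conformal map);
* `stub_bulkFreeRatio` (= `BulkFreeRatio`; L, PRINTED: CHI15 Thm 1.1 free case, crux convention,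
  divided): the bulk nested ratio at fixed interior `z ≠ w` converges to the ratio of CHI's explicit
  free two-point functions `twoPointFreeCHI` of `D'` and `D`;
* `BoundaryFusion` (M, explicit): that continuum ratio tends to `d^{1/2} = Φ'_A(0)^{1/2}` as
  `(z, w) → (a, b)` inside `D'` — RESHAPED by the line lead (cycle 1) into three registered stubs:
  `stub_restrictionMapAtZero` (`Im Φζ/Im ζ → d`, `Φ'ζ → d` at `0`), `stub_restrictionMapAtInfty`
  (the same at `∞`, from the statement at `0` by inversion) and `stub_boundaryFusionCore` (the two
  restriction-map facts ⇒ `BoundaryFusion`: chain rule, `u`-asymptotics, Carathéodory).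

STATE AFTER CYCLE 1 (rev 3, line lead): `stub_restrictionMapAtZero` (p86712),
`stub_restrictionMapAtInfty` (p88223), `stub_boundaryFusionCore` (p87614) are LANDED under
`Theorems/SAWLoopFugacityFlowIsingBoundaryRatio*.lean` and referenced here by name;
`stub_bulkFreeRatio` is LANDED CONDITIONALLY (p91239, `bulkFreeRatio_of_chi`) on the Literature named
fact `chi_twoPoint_free_jordan` (p88667, CHI15 Thm 1.1 free, unproved in tree), carried below as the
`sorry`'d `stub_chiTwoPointFreeJordan` (named fact X — debt queue, not a worker task). Exactly two
`sorry`s remain: `stub_anchorLocality` (unprinted; see `Lines/fk_anchor_transfer_stuck.md`; the Edwards–Sokal form of `T` is landed as `Theorems.IsingBoundaryRatio.stub_T_eq_fkConn`, p92083) and X.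

STATE AFTER CYCLE 2 (rev 4, re-seated line lead `prover-line-stmt-CriticalPhenomena-10650-1`):
`stub_anchorLocality` is RESHAPED along its FK proof into five registered stubs —
`stub_chartAnnulusSeparation` (lattice/Carathéodory, provable now), `stub_roughHalfAnnulusRSW`
(CDH16 Thm 1.1-type crossing bounds in the lattice conformal half-annuli at the rough prime end,
uniform in boundary conditions; printed input, XL to formalise), `stub_armOriginForgettingCore`
(THE HEART: Kesten/GPS/CGN-type coupling ⇒ arm-origin forgetting at `pt 0`, XL),
`stub_reverseDobrushin` (swap the marked points, S), `stub_localAgreementTransfer`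
(`ArmOriginForgetting → AnchorLocality`, M) — and PROVED from them below; see the section
"STUB 1 (`AnchorLocality`) — RESHAPED".

STATE AFTER CYCLES c1/c2 (rev 5, leads `…-c1-0`, `…-c2-0`): 1a (`stub_chartAnnulusSeparation`, p100534) and
1d (`stub_reverseDobrushin`, p102561) are LANDED and referenced below by name; the rev-4 heart target
`ArmOriginForgettingAt` is FALSE (`not_armOriginForgetting`, p102702: a far spin reachable only through vertices
outside the finite volume has a zero two-point function), so 1c is RE-AIMED at the REPAIRED target
`ArmOriginForgettingAt'` of the Defs file (in-volume walks; p106467) — `stub_armOriginForgettingCore'` — and 1e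
becomes the honest `stub_localAgreementTransfer'` (`ArmOriginForgetting' → AnchorLocality`, PROVED by the c1 lead,
landed by the c2 lead). All objects (`LocalAgreement`, `freeTwoPoint`, `ChartAnnulusSeparation`, `annIn/annBody`,
`AnnSep/AnnCross`, `RoughHalfAnnulusRSW`, `ArmOriginForgettingAt'`) are now the TREE's
(`Theorems/SAWLoopFugacityFlowIsingBoundaryRatioForgettingDefs.lean`), no local copies. Open after c2 cycle 1 (rev 5b): 1b (printed input; reduced by the wave to the mesh graph with
extremal b.c., `RoughHalfAnnulusRSWMeshOf`), 1c'β (the FK heart `stub_fkArmOriginForgetting`; 1c'α Edwards–Sokal glue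
LANDED p111411, 1e' LANDED p111453), X (printed named fact).

STATE AFTER CYCLE c2-1 (rev 6→7: rev 7 splits the RSW residual by the wave-2 decomposition into `stub_chartDiscOneComponent`,
`stub_halfAnnulusSideCrossingBound`, `stub_halfAnnulusRimCrossingBound` — CDH16 Thm 1.1 itself is LANDED as the Literature fact
`fkIsing_topologicalRectangle_crossingBounds`, p116190; rev 6, lead `…-c2-0`, 2026-08-16 16:30Z): LANDED this cycle — the Defs targets
`ArmOriginForgettingAt'`/`ArmOriginForgetting'` (p106467) and `FKArmOriginForgettingAt` (p109720), 1c'α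
`stub_freeTwoPoint_eq_fkConn` (p111411), 1e' `stub_localAgreementTransfer'` (p111453), the wave's far-graph /
boundary-condition reduction of the RSW stub (`…RSWDefs`, `roughHalfAnnulusRSW_of_mesh` p113211,
`roughHalfAnnulusRSWPath_of_pathMesh` p113654) and four Literature bricks of the heart (p108537, p108843, p109709,
p109962). REGISTERED OPEN STUBS (rev 6): `stub_roughHalfAnnulusRSWMesh` (= `RoughHalfAnnulusRSWMeshOf AnnPathSepG`:
mesh graph, extremal b.c., PATH separators; printed inputs CDH16 Thm 1.1 + Chelkak toolbox + lattice topology),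
`stub_fkArmOriginForgettingPath` (the FK heart with the path-form RSW hypothesis) and X; the rev-5 names
`stub_roughHalfAnnulusRSW`, `stub_fkArmOriginForgetting`, `stub_armOriginForgettingCore'`, `stub_anchorLocality` are
PROVED below from them.

PROVED here (no `sorry` outside the registered stubs): `anchorTransfer_of_anchorLocality` (two-end
transfer in difference form: anchor locality at `a` with far spin `b_δ`, then at `b` with far spin
`[z/δ]`, symmetry of `⟨σσ⟩`, GKS-II sandwich `T_mono`, GKS-I positivity `T_pos_of_reachable`, bulk sites
of a Jordan subdomain eventually in `Ω'_δ` — `eventually_bulk_reachable`), `normalForm_of_transfer` (the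
`3η` argument: the product filter `𝓝[D'] a ×ˢ 𝓝[D'] b` is non-trivial, pick `(z, w)` there, then
`BulkFreeRatio` pins the lattice bulk ratio) and the composition `IsingBoundaryRatio_of :
AnchorLocality → BulkFreeRatio → BoundaryFusion → IsingBoundaryRatio` (hypotheses spelled through the
name-keyed aliases `Registered.stub_*`) BY NAME through the landed equivalence
`Negative.isingBoundaryRatio_iff_normalForm`.

DISPROOF USED (`Cruxes/IsingBoundaryRatio/Disproof.lean`, cdisprove gen 1; landed as
`Theorems/IsingBoundaryRatio/Negative/IsingBoundaryRatio{Lattice,Nesting,Normalisation}.lean`, imported):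
`isingBoundaryRatio_false_without_IsRestrictionMap` / `_HasRestrictionDeriv` — the line uses BOTH
hypotheses at `stub_boundaryFusion` (they pin `d`; the other two stubs are `d`-free); the load-bearing
INNER approximation `IsEndpointApprox D' a b` is used in `anchorTransfer_of_anchorLocality`
(reachability of `a_δ, b_δ` in `Ω'_δ`, `eventually_meshDomain_subset`); the idle hypotheses (outer
approximation, `pt` equalities) are used only for convenience (`normalForm_of_transfer` uses
`D'.pt i = D.pt i` to see `a, b ∈ closure D'`); `crux_diag` / `eventually_ratio_mem_Ioc` /
`limit_le_one`: on the diagonal `D' = D` every stub is consistent (`AnchorLocality`: double ratio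
`≡ 1`; `BulkFreeRatio`: ratio `≡ 1 →` `1`; `BoundaryFusion`: `A = ∅`, `d = 1`), and `d^{1/2} ≤ 1`. No
landed Negative lemma refutes an instance of any stub (they concern dropped normalisations, the
two-sided filter and negative exponents). Negatives index: no refuted statement of the summit concerns
Ising correlation ratios; no stub uses an all-`δ` quantifier (stmt-0772 pattern) — every lattice
statement is along `𝓝[>] 0`.

WORKER HEADER (to restate a registered stub verbatim): the first two imports of this module + `Literature.Probability.LatticeModels.PlanarIsingOnePointProofs`, then
`open scoped Topology` and `open Filter Set Metric Literature.Probability.LatticeModels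
Literature.Probability.RandomPlanarGeometry Summit.CriticalPhenomena.SAWScalingLimit.Theorems.IsingBoundaryRatio.Negative`
(`T Ω δ x y` = the landed normal form of the crux's inline free two-point function, `inline_eq_T`).
-/

noncomputable section

open scoped Classical Topology
open MeasureTheory Filter Set Function Metric
open Literature.Probability.LatticeModels Literature.Probability.RandomPlanarGeometry
open UpperHalfPlane (upperHalfPlaneSet)
open SimpleGraph (fromEdgeSet)
open Literature.Probability.Percolation (BondConfig openConn openConnIn openCrossing explEvent)

namespace Summit.CriticalPhenomena.SAWScalingLimit.Cruxes.IsingBoundaryRatio.FkAnchorTransfer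

open Summit.CriticalPhenomena.SAWScalingLimit.Theorems.IsingBoundaryRatio.Negative
open Summit.CriticalPhenomena.SAWScalingLimit.Theorems.IsingBoundaryRatio (LocalAgreement freeTwoPoint
  ArmOriginForgettingAt' ArmOriginForgetting' FKArmOriginForgettingAt ChartAnnulusSeparation annIn annBody AnnSep AnnCross
  RoughHalfAnnulusRSW annEdgeFinset AnnLink AnnPathSep AnnPathSepG RoughHalfAnnulusRSWOf RoughHalfAnnulusRSWMeshOf
  roughHalfAnnulusRSW_of_mesh roughHalfAnnulusRSWPath_of_pathMesh annSep_of_annPathSep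
  ChartDiscOneComponent HalfAnnulusSideCrossingBound HalfAnnulusRimCrossingBound roughHalfAnnulusRSWMesh_of_crossingBounds
  annSideCrossSeparation HalfAnnulusRimCrossingBoundLarge RoughHalfAnnulusRSWMeshLargeOf RoughHalfAnnulusRSWLargeOf
  roughHalfAnnulusRSWMeshLarge_of_bounds roughHalfAnnulusRSWPathLarge_of_pathMeshLarge IsWindowRect
  WindowRectPresentation WindowExtResistanceBound AnnCrossThroughWindowRect halfAnnulusSideCrossingBound_of
  halfAnnulusRimCrossingBoundLarge_of' windowExtResistanceBound_holds annCrossThroughWindowRect_holds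
  HalfAnnulusRadialCrossingBoundFat)

/-! ### The statements of the line (named `Prop`s over existing declarations)

`T Ω δ x y = ⟨σ_xσ_y⟩^free_{Ω_δ; β_c, 0}` is the landed normal form of the crux's inline two-point
function (`Theorems/IsingBoundaryRatio/Negative/IsingBoundaryRatioLattice.lean`, `inline_eq_T`). -/

/-- **Anchor locality at a marked prime end** (the lever; ONE marked point at a time). For the hull
subdomain `D' ⊆ D` agreeing with `D` in the ball `B(D.pt i, ε)`, for every `c > 0` and `η > 0` there
is `r > 0` such that for any two anchor families `x_δ, x'_δ` whose mesh points are eventually in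
`B(D.pt i, r)` and any far family `y_δ` eventually at distance `≥ c` from `D.pt i`, all joined in
`Ω'_δ`, the DOUBLE RATIO `[⟨σ_xσ_y⟩_{Ω'}/⟨σ_{x'}σ_y⟩_{Ω'}] / [⟨σ_xσ_y⟩_{Ω}/⟨σ_{x'}σ_y⟩_{Ω}]` is
eventually within `η` of `1`: the ratio of the two anchors' correlations with a far spin forgets the
domain (and the far spin) beyond `B(D.pt i, ε)`. Mechanism: Edwards–Sokal, then conditionally on the
FK arm from the anchor reaching scale `s ≫ r` the configuration beyond forgets the anchor
(RSW in conformal half-annuli uniformly in boundary conditions — CDH16 —, FKG, domain Markov), while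
inside `B(D.pt i, ε)` the graphs `Ω_δ`, `Ω'_δ` coincide. Value-free, no conformal map. -/
def AnchorLocality : Prop :=
  ∀ (D D' : DobrushinDomain) (i : Fin 2) (ε : ℝ), D'.carrier ⊆ D.carrier → 0 < ε →
    D'.carrier ∩ ball (D.pt i) ε = D.carrier ∩ ball (D.pt i) ε →
    ∀ c : ℝ, 0 < c → ∀ η : ℝ, 0 < η → ∃ r : ℝ, 0 < r ∧
      ∀ (x x' y : ℝ → Site 2),
        (∀ᶠ δ in 𝓝[>] (0 : ℝ), dist (meshPoint δ (x δ)) (D.pt i) < r) →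
        (∀ᶠ δ in 𝓝[>] (0 : ℝ), dist (meshPoint δ (x' δ)) (D.pt i) < r) →
        (∀ᶠ δ in 𝓝[>] (0 : ℝ), c ≤ dist (meshPoint δ (y δ)) (D.pt i)) →
        (∀ᶠ δ in 𝓝[>] (0 : ℝ), (discreteDomainGraph D'.carrier δ).Reachable (x δ) (y δ) ∧
          (discreteDomainGraph D'.carrier δ).Reachable (x' δ) (y δ)) →
        (∀ᶠ δ in 𝓝[>] (0 : ℝ), meshDomain D'.carrier δ ⊆ meshDomain D.carrier δ) →
        ∀ᶠ δ in 𝓝[>] (0 : ℝ),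
          |T D'.carrier δ (x δ) (y δ) / T D'.carrier δ (x' δ) (y δ) /
              (T D.carrier δ (x δ) (y δ) / T D.carrier δ (x' δ) (y δ)) - 1| < η

/-- **Anchor transfer** (two ends, difference form; PROVED below from `AnchorLocality`): under the
crux's hypotheses, for every `η > 0` there is `r > 0` such that for bulk points `z, w ∈ D'` within
`r` of `a = D.pt 0`, `b = D.pt 1`, the crux's nested ratio and the nested ratio of the bulk two-point
functions `⟨σ_{[z/δ]}σ_{[w/δ]}⟩^free` are eventually within `η`. -/
def AnchorTransfer : Prop :=
  ∀ (D D' : DobrushinDomain) (a b : ℝ → Site 2), SAW.IsEndpointApprox D a b →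
    SAW.IsEndpointApprox D' a b → D'.carrier ⊆ D.carrier →
    (∃ ε : ℝ, 0 < ε ∧ D'.carrier ∩ ball (D.pt 0) ε = D.carrier ∩ ball (D.pt 0) ε ∧
      D'.carrier ∩ ball (D.pt 1) ε = D.carrier ∩ ball (D.pt 1) ε) →
    ∀ η : ℝ, 0 < η → ∃ r : ℝ, 0 < r ∧ ∀ z w : ℂ, z ∈ D'.carrier → w ∈ D'.carrier →
      dist z (D.pt 0) < r → dist w (D.pt 1) < r →
      ∀ᶠ δ in 𝓝[>] (0 : ℝ),
        |T D'.carrier δ (a δ) (b δ) / T D.carrier δ (a δ) (b δ) -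
          T D'.carrier δ (nearestSite δ z) (nearestSite δ w) /
            T D.carrier δ (nearestSite δ z) (nearestSite δ w)| < η

/-- **Bulk free two-point ratio** (CHI15 Thm 1.1, free boundary conditions, for the crux's
discretisation — graph `Ω_δ`, ALL its sites free —, in nested-ratio form): for fixed interior points
`z ≠ w` of `D' ⊆ D`, `⟨σ_{[z/δ]}σ_{[w/δ]}⟩^free_{Ω'_δ} / ⟨σ_{[z/δ]}σ_{[w/δ]}⟩^free_{Ω_δ}` converges to
the ratio of CHI's explicit continuum free two-point functions (`twoPointFreeCHI`, eqs. (1.2)–(1.3))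
of `D'` and `D`, written through the conformal charts `Φ ∘ φ⁻¹ : D' → ℍ` and `φ⁻¹ : D → ℍ` (any
conformal chart gives the same value; CHI's lattice normalisation `ϱ(δ)` cancels). -/
def BulkFreeRatio : Prop :=
  ∀ (D D' : DobrushinDomain), D'.carrier ⊆ D.carrier →
    ∀ (φ : ConformalEquiv upperHalfPlaneSet D.carrier) (A : Set ℂ),
      A = closure (upperHalfPlaneSet \ {z | z ∈ upperHalfPlaneSet ∧ φ z ∈ D'.carrier}) →
    ∀ (Φ : ConformalEquiv (upperHalfPlaneSet \ A) upperHalfPlaneSet) (z w : ℂ),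
      z ∈ D'.carrier → w ∈ D'.carrier → z ≠ w →
      Tendsto (fun δ => T D'.carrier δ (nearestSite δ z) (nearestSite δ w) /
          T D.carrier δ (nearestSite δ z) (nearestSite δ w)) (𝓝[>] 0)
        (𝓝 (twoPointFreeCHI (fun x => Φ (φ.symm x)) z w / twoPointFreeCHI (fun x => φ.symm x) z w))

/-- **Boundary fusion** (continuum, explicit; the marked points of `D'` are those of `D` — idle for
the crux, Disproof §1, but they make `D'` a `MarkedDomain.IsHullSubdomain` of `D` verbatim, so that
`Negative.starHull_and_deriv_mem` gives `A ∈ 𝒬*`, `0 < d ≤ 1`): the ratio of CHI's free two-point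
functions of `D' ⊆ D` tends to `d^{1/2} = Φ'_A(0)^{1/2}` as `(z, w) → (a, b)` inside `D'`. In the chart
`ζ = φ⁻¹ z → 0`, `ξ = φ⁻¹ w → ∞`: `u⁻¹ − u ∼ 2 Im ζ Im ξ / |ξ|²`, `Im Φζ / Im ζ → d`,
`Im Φξ / Im ξ → 1`, `|Φ'(ζ)| → d`, `|Φ'(ξ)| → 1` (Schwarz reflection of `Φ_A` at `0` and `∞`), so the
ratio is `d^{1/2}·d^{-1/8}·d^{1/8} = d^{1/2}`; Carathéodory (Jordan `D`) sends `z → a`, `w → b` to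
`ζ → 0`, `ξ → ∞`. -/
def BoundaryFusion : Prop :=
  ∀ (D D' : DobrushinDomain), D'.carrier ⊆ D.carrier → D'.pt 0 = D.pt 0 → D'.pt 1 = D.pt 1 →
    (∃ ε : ℝ, 0 < ε ∧ D'.carrier ∩ ball (D.pt 0) ε = D.carrier ∩ ball (D.pt 0) ε ∧
      D'.carrier ∩ ball (D.pt 1) ε = D.carrier ∩ ball (D.pt 1) ε) →
    ∀ (φ : ConformalEquiv upperHalfPlaneSet D.carrier), D.IsChordalUniformizing φ →
    ∀ (A : Set ℂ), A = closure (upperHalfPlaneSet \ {z | z ∈ upperHalfPlaneSet ∧ φ z ∈ D'.carrier}) →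
    ∀ (Φ : ConformalEquiv (upperHalfPlaneSet \ A) upperHalfPlaneSet) (d : ℝ),
      IsRestrictionMap A Φ → HasRestrictionDeriv A Φ d →
      Tendsto (fun p : ℂ × ℂ => twoPointFreeCHI (fun x => Φ (φ.symm x)) p.1 p.2 /
          twoPointFreeCHI (fun x => φ.symm x) p.1 p.2)
        (𝓝[D'.carrier] (D.pt 0) ×ˢ 𝓝[D'.carrier] (D.pt 1)) (𝓝 (d ^ ((1 : ℝ) / 2)))

/-! ### The registered stubs (statements expanded over existing declarations; `T` is
`Summit.CriticalPhenomena.SAWScalingLimit.Theorems.IsingBoundaryRatio.Negative.T`, the landed normal form of the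
crux's inline free two-point function — a worker's file needs the first two imports of this module (+ `PlanarIsingOnePointProofs`) and
`open Literature.Probability.LatticeModels Literature.Probability.RandomPlanarGeometry Filter Metric
Summit.CriticalPhenomena.SAWScalingLimit.Theorems.IsingBoundaryRatio.Negative` + `open scoped Topology`) -/

/-! ### STUB 1 (`AnchorLocality`) — RESHAPED by the line lead (re-seat, 2026-08-16, cycle 2)
along its intended FK proof into FIVE registered stubs (three provable now, two carrying the
analytic heart):

* `stub_chartAnnulusSeparation` (M, PROVABLE NOW; = `ChartAnnulusSeparation`): in the chordal chart
  `φ : ℍ → D`, every path of `Ω_δ` from chart radius `≤ ρ₁` to chart radius `≥ ρ₂` visits a site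
  of chart radius in `(ρ₁, ρ₂)` once `δ` is small (uniform continuity of the capped chart radius
  `min(‖φ⁻¹·‖, ρ₂)` on the compact closure of `D` — Carathéodory:
  `IsChordalUniformizing.exists_tendsto_symm_of_mem_frontier`, `tendsto_symm_cocompact`);
* `stub_roughHalfAnnulusRSW` (XL, PRINTED INPUT; = `RoughHalfAnnulusRSW`): RSW in the lattice
  conformal half-annuli `φ({ρ < |w| < Mρ})` at the rough marked prime end `a = D.pt 0`, uniformly in
  the configuration outside and over all finite supergraphs agreeing with `Ω_δ` near `a`:
  conditionally on any cylinder event off the annulus, an open path inside the annulus separating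
  its inside from its outside exists with probability `≥ c`, and an open radial crossing with
  probability `≤ 1 - c` (Chelkak–Duminil-Copin–Hongler 2016, arXiv:1312.7785 Thm 1.1 — crossing
  bounds in discrete topological rectangles in terms of the discrete extremal length ONLY, uniform in
  boundary conditions — plus Chelkak 2012 comparability of discrete and continuous extremal length;
  tree: `effectiveResistance`/`extremalLength` (EffectiveResistance.lean), conditional cylinder
  form as in `rcMeasure_real_inter_cylinder_le_mul_fromEdgeSet`);
* `stub_armOriginForgettingCore` (XL, THE HEART, folklore-unprinted at a rough boundary point;
  = the two previous statements ⇒ `ArmOriginForgettingAt D.carrier (D.pt 0)` for every Dobrushin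
  domain): Kesten (1986) / Garban–Pete–Schramm (2013) §3 / Camia–Garban–Newman (2015) Lemma 3.2-type
  coupling of conditioned critical FK-Ising measures across `N → ∞` conformal half-annuli (Edwards–Sokal
  `edwardsSokal_twoPoint_holds`, FKG `rcMeasure_fkg_holds`, domain Markov with exploration-induced wiring
  `rcMeasure_real_inter_cylinder_eq_mul_fromEdgeSet_of_reachable`, conditional domination
  `rcMeasure_real_inter_cylinder_le_mul_fromEdgeSet`, quasi-multiplicativity from the RSW stub);
* `stub_reverseDobrushin` (S, PROVABLE NOW): a Dobrushin domain with the marked points swapped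
  (same carrier, `pt 0 ↦ pt 1`) — transports the heart from `D.pt 0` to `D.pt 1`;
* `stub_localAgreementTransfer` (M, PROVABLE NOW; = `ArmOriginForgetting → AnchorLocality`): the
  two mesh graphs `Ω'_δ ⊆ Ω_δ` of `D' ⊆ D` agreeing in `B(D.pt i, ε)` both AGREE LOCALLY with `Ω_δ`
  in `B(D.pt i, ε/2)` (an `Ω_δ`-edge at a site of `Ω'_δ` inside the ball is an `Ω'_δ`-edge: its
  segment lies in `closure D ∩ B = closure D' ∩ B`, and a mesh-neighbour of a site of a maximal
  component is in that component), so anchor locality is arm-origin forgetting applied to the pair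
  of finite-volume graphs `(Ω'_δ, meshDomainFinset D' δ)`, `(Ω_δ, meshDomainFinset D δ)`.
The composition `stub_anchorLocality` below is PROVED from the five (modus ponens + `Fin 2` cases). -/

/-! The objects of stubs 1a–1e (`LocalAgreement`, `freeTwoPoint`, `ArmOriginForgettingAt'`,
`ChartAnnulusSeparation`, `annIn`, `annBody`, `AnnSep`, `AnnCross`, `RoughHalfAnnulusRSW`) are the tree's
(`Theorems/SAWLoopFugacityFlowIsingBoundaryRatioForgettingDefs.lean`, namespace
`Summit.CriticalPhenomena.SAWScalingLimit.Theorems.IsingBoundaryRatio`, opened above). -/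

/-- `freeTwoPoint` of the mesh graph is the crux's normal form `T` (`rfl`). -/
theorem freeTwoPoint_eq_T (Ω : Set ℂ) (δ : ℝ) (x y : Site 2) :
    freeTwoPoint (discreteDomainGraph Ω δ) (meshDomainFinset Ω δ) x y = T Ω δ x y := rfl

/-- STUB 1a (= `ChartAnnulusSeparation`; LANDED p100534, lead-1's team). -/
theorem stub_chartAnnulusSeparation :
    ∀ (D : DobrushinDomain) (φ : ConformalEquiv UpperHalfPlane.upperHalfPlaneSet D.carrier),
      D.IsChordalUniformizing φ → ∀ (ρ₁ ρ₂ : ℝ), 0 < ρ₁ → ρ₁ < ρ₂ →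
        ∀ᶠ δ in 𝓝[>] (0 : ℝ), ∀ (u v : Site 2) (w : (discreteDomainGraph D.carrier δ).Walk u v),
          ‖φ.symm (meshPoint δ u)‖ ≤ ρ₁ → ρ₂ ≤ ‖φ.symm (meshPoint δ v)‖ →
            ∃ z ∈ w.support, ρ₁ < ‖φ.symm (meshPoint δ z)‖ ∧ ‖φ.symm (meshPoint δ z)‖ < ρ₂ :=
  Summit.CriticalPhenomena.SAWScalingLimit.Theorems.IsingBoundaryRatio.stub_chartAnnulusSeparation

/-- STUB 1b″(0) (L, lattice topology, rev 7; = `ChartDiscOneComponent`, the lead's (G3)/(G-d) one-ball-component lemma isolated by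
wave 2): for small `δ` all `Ω_δ`-sites of chart radius `< Mρ` lie in ONE component of `Ω_δ ∩ B(a, ε)`. CONTEXT — rough half-annulus RSW for
the MESH graph `Ω_δ` with EXTREMAL boundary conditions and the guarded PATH form of the separation event — for the
chordal chart `φ` and `M > 1` there is `c > 0` such that for every localisation radius `ε`, every chart scale
`ρ < ρ₀(ε)`, all small `δ` and every finite set of sites `Λ` closed under `Ω_δ`-neighbours inside `B(a, ε)`:
the FREE critical FK–Ising measure of the local graph `⟨U⟩` (`U` = edges of `Ω_δ|_Λ` touching the annulus) gives
the event "some walk joins `In` to the outside ⇒ an OPEN PATH inside the annulus whose support meets every such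
walk" probability `≥ c`, and the measure of `⟨U⟩` with every vertex off the annulus WIRED gives the open radial
crossing probability `≤ 1 - c`. This is the residual of the cycle-c2 wave (worker `stub-blocked`: no printed
input in the tree): Chelkak–Duminil-Copin–Hongler 2016 Thm 1.1 (crossing bounds in discrete topological
rectangles by the discrete extremal length alone, any b.c.) + Chelkak's toolbox §6–7 (discrete vs continuous
extremal length) + the planar topology of `Ω_δ ⊆ δℤ²` at the rough arcs (a rough-side-to-rough-side open crossing
is a vertex cut; for small `δ` one ball-component). The far graph, the configuration `ξ` off the annulus and
the cylinder form are REMOVED by the landed reduction `roughHalfAnnulusRSWPath_of_pathMesh` /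
`roughHalfAnnulusRSW_of_mesh` (Grimmett L4.13/4.14(b), CDH16 Rem. 2.2). PATH (not set) separators because the
heart's Markov step needs the separator wired along its own open edges (star counterexample,
`Lines/fk_anchor_transfer_c2_heart_blueprint.md` §4). -/
theorem stub_chartDiscOneComponent : ChartDiscOneComponent :=
  Summit.CriticalPhenomena.SAWScalingLimit.Theorems.IsingBoundaryRatio.stub_chartDiscOneComponent

/-- STUB 1b″-rect (XL, rev 9; = `WindowRectPresentation`, registered sub-goal `windowRectPresentation_holds`, worker): the lattice
window of the conformal half-annulus admits a presentation `IsWindowRect` as a discrete topological rectangle (filled induced edge set of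
the bulk component; one boundary cycle by winding numbers; the two rough stretches and the rim darts sit on the expected arcs by the
non-interleaving theorem). Helper library LANDED by the wave-3 worker: `…WindowRect{Succ,GeomDefs,PolygonRange,PolygonCoords,PolygonAvoid,
PolygonWinding,HoleCells,Holes,HoleRadius,EdgeSet,Cover,Routes,Whisker,Chart,Tails}.lean`; remaining: Joins/NonInterleave + assembly. LANDED rev 14 (worker W1, p133851: `Theorems/SAWLoopFugacityFlowIsingBoundaryRatioWindowRectPresentation.lean` + 20 helper modules). -/
theorem stub_windowRectPresentation : WindowRectPresentation :=
  Summit.CriticalPhenomena.SAWScalingLimit.Theorems.IsingBoundaryRatio.windowRectPresentation_holds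

/-- STUB 1b″-fact (PRINTED NAMED FACT — debt queue, NOT a worker task; rev 10): Chelkak–Duminil-Copin–Hongler 2016
Thm 1.1 (crossing probabilities in discrete topological rectangles, any boundary condition, in terms of the resistance
between the inner arcs; `fkIsing_topologicalRectangle_crossingBounds`, Literature fact landed p116190, UNPROVED in the tree —
its printed proof needs Chelkak's toolbox, the two-observable representation and separator surgery; bricks accumulate in
`Literature/…/FKIsingTopologicalRectangleCrossingProofs.lean`). The two §3.3 resistance facts of the rev-8 conjunction are
discharged (see `stub_cdh16`). -/
theorem stub_cdh16Thm11 :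
    Literature.Probability.LatticeModels.fkIsing_topologicalRectangle_crossingBounds := by
  sorry

/-- STUB 1b″-facts in its rev-8 registered form (the conjunction of the three CDH16 inputs): rev 10 — PROVED from
`stub_cdh16Thm11` (the one remaining named fact, CDH16 Thm 1.1) and the two §3.3 resistance facts, which are DISCHARGED
in the tree (`discreteEL_ext_sandwich_holds`, `…ExternalArcsProofs.lean`; `discreteEL_ext_selfDual_holds`,
`…ExternalArcsSelfDual.lean`, `C = 5476`). -/
theorem stub_cdh16 :
    Literature.Probability.LatticeModels.fkIsing_topologicalRectangle_crossingBounds ∧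
      Literature.Probability.LatticeModels.discreteEL_ext_sandwich ∧
      Literature.Probability.LatticeModels.discreteEL_ext_selfDual :=
  ⟨stub_cdh16Thm11, Literature.Probability.LatticeModels.discreteEL_ext_sandwich_holds,
    Literature.Probability.LatticeModels.discreteEL_ext_selfDual_holds⟩

/-- STUB 1b″(i) (rev 9: PROVED modulo 1b″-rect by the LANDED plumbing `halfAnnulusSideCrossingBound_of` p122516 + `windowExtResistanceBound_holds` p124911; = `fkIsing_topologicalRectangle_crossingBounds → discreteEL_ext_sandwich →
HalfAnnulusSideCrossingBound`): CDH16 Thm 1.1 (i) instance — under the FREE local measure, an open crossing between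
the two (windowed) rough sides of the lattice conformal half-annulus has probability `≥ c(M)`. Sub-goals (registered,
workers): `windowRectPresentation_holds : WindowRectPresentation` (present the lattice window as an `IsWindowRect`,
lattice topology), `windowExtResistanceBound_holds : WindowExtResistanceBound` (resistance of `Ω̄` between the external
arcs of the rough sides `≤ C / log (r₂'/r₁')`, Chelkak 2016 Prop 6.2 (i) by a foliation by chart semicircles), and the
plumbing `halfAnnulusSideCrossingBound_of` (`ℓ ≤ ℓ̄ ≤ C/log M^{1/4}`, Thm 1.1 (i) on `⟨E⟩`, free measures increase with
the domain, the crossing of `E` is an `AnnSideCross`). -/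
theorem stub_halfAnnulusSideCrossingBound :
    Literature.Probability.LatticeModels.fkIsing_topologicalRectangle_crossingBounds →
      Literature.Probability.LatticeModels.discreteEL_ext_sandwich → HalfAnnulusSideCrossingBound :=
  fun h1 h2 => halfAnnulusSideCrossingBound_of h1 h2 stub_windowRectPresentation windowExtResistanceBound_holds

/-- STUB 1b″(ii) (rev 9: PROVED modulo 1b″-rect by the LANDED `halfAnnulusRimCrossingBoundLarge_of'` p123782 + `annCrossThroughWindowRect_holds` p124903 + resistance bound; = `fkIsing_topologicalRectangle_crossingBounds → discreteEL_ext_sandwich →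
discreteEL_ext_selfDual → HalfAnnulusRimCrossingBoundLarge`): CDH16 Thm 1.1 (ii) instance in LARGE-MODULUS form —
under the measure with everything off the annulus WIRED, an open radial crossing has probability `≤ 1 - c(M)` for
`M ≥ M₀`: the same presentation and resistance bound, `ℓ_Ω[(rims)] ≥ ℓ_Ω̄[(rims)] − 4(2√2−1) ≥ c₀ log(M^{1/4})/C −
4(2√2−1) ≥ 1`, Thm 1.1 (ii) on `⟨E⟩` with all boundary vertices wired (comparison of boundary conditions + domain
Markov), and a radial crossing of the annulus crosses `E` from the arc of the inner rim darts to the arc of the outer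
ones (`IsWindowRect.closed/bulk_mem/rim_darts`). Sub-goal (registered, worker): `halfAnnulusRimCrossingBoundLarge_of`. -/
theorem stub_halfAnnulusRimCrossingBoundLarge :
    Literature.Probability.LatticeModels.fkIsing_topologicalRectangle_crossingBounds →
      Literature.Probability.LatticeModels.discreteEL_ext_sandwich →
      Literature.Probability.LatticeModels.discreteEL_ext_selfDual → HalfAnnulusRimCrossingBoundLarge :=
  fun h1 h2 h3 => halfAnnulusRimCrossingBoundLarge_of' h1 h2 h3 stub_windowRectPresentation windowExtResistanceBound_holds
    annCrossThroughWindowRect_holds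

/-- 1b″ in LARGE-MODULUS form (= `RoughHalfAnnulusRSWMeshLargeOf AnnPathSepG`; rev 8: PROVED from 1b″(0)
one-ball-component, 1b″(i), 1b″(ii)-large and the facts by the LANDED large-modulus twin
`roughHalfAnnulusRSWMeshLarge_of_bounds` of the wave-2 decomposition, whose planar part `annSideCrossSeparation`
is PROVED). -/
theorem roughHalfAnnulusRSWMeshLarge_holds : RoughHalfAnnulusRSWMeshLargeOf AnnPathSepG :=
  roughHalfAnnulusRSWMeshLarge_of_bounds annSideCrossSeparation stub_chartDiscOneComponent
    (stub_halfAnnulusSideCrossingBound stub_cdh16.1 stub_cdh16.2.1)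
    (stub_halfAnnulusRimCrossingBoundLarge stub_cdh16.1 stub_cdh16.2.1 stub_cdh16.2.2)

/-- The conditional-cylinder RSW with PATH separators for every finite supergraph, LARGE-MODULUS form (what the
heart consumes), by the LANDED twin reduction `roughHalfAnnulusRSWPathLarge_of_pathMeshLarge`. -/
theorem roughHalfAnnulusRSWLarge_holds : RoughHalfAnnulusRSWLargeOf AnnPathSepG :=
  roughHalfAnnulusRSWPathLarge_of_pathMeshLarge roughHalfAnnulusRSWMeshLarge_holds

/-- STUB 1c'α (S, heart glue; Edwards–Sokal for finite volumes; LANDED p111411, c2 lead): the free critical Ising two-point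
function of `(G, Λ)` is the connection probability of the free critical FK–Ising measure of `G.comap val` on
`↥Λ` (`isingTwoPoint_free_map` + `edwardsSokal_twoPoint_holds`; cf. `stub_T_eq_fkConn`, p92083). -/
theorem stub_freeTwoPoint_eq_fkConn :
    ∀ (G : SimpleGraph (Site 2)) [G.LocallyFinite] (Λ : Finset (Site 2)) (x y : Site 2)
      (hx : x ∈ Λ) (hy : y ∈ Λ),
      freeTwoPoint G Λ x y =
        (rcMeasure (G.comap (Subtype.val : ↥Λ → Site 2)) (1 - Real.exp (-2 * criticalBetaTwo)) 2 ∅).real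
          (Literature.Probability.Percolation.openConn (⟨x, hx⟩ : ↥Λ) ⟨y, hy⟩) :=
  Summit.CriticalPhenomena.SAWScalingLimit.Theorems.IsingBoundaryRatio.stub_freeTwoPoint_eq_fkConn

/-- STUB 1c'β″ (XL, THE HEART, rev 11: Basu–Sapozhnikov exploration data, blueprint
`Lines/fk_anchor_transfer_c3_heart_v3.md`; = `ChartAnnulusSeparation → RoughHalfAnnulusRSWMeshLargeOf AnnPathSepG →
HalfAnnulusRadialCrossingBoundFat → RoughHalfAnnulusRSWLargeOf AnnPathSepG → ∀ D, FKArmOriginForgettingAt D.carrier (D.pt 0)`;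
the mesh-local RSW clauses (i) free separator / (ii) wired no-radial-crossing feed the monotone boundary-condition toolkit,
clause (iii) the quasi-multiplicativity gluing, the conditional-cylinder form the top-level junk bound in an arbitrary
supergraph; landed bricks: `kesten_multilevel_osc_le` p127828, `rcMeasure_real_inter_inter_biInter_compl_le` p128236,
block-exploration defs p127874/p128307 + API p128660). Below, the rev-8 text. STUB 1c'β′ (XL, THE HEART, rev 8, percolation language, LARGE-MODULUS PATH-form RSW; =
`ChartAnnulusSeparation → RoughHalfAnnulusRSWLargeOf AnnPathSepG → ∀ D, FKArmOriginForgettingAt D.carrier (D.pt 0)`):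
arm-origin forgetting for free critical FK–Ising connection probabilities at the rough free prime end `a = D.pt 0`,
uniformly over finite supergraphs of the local mesh graph, from chart-annulus separation (1a, landed) and the
conditional RSW with open separating PATHS in the lattice conformal half-annuli of ONE large modulus
(`roughHalfAnnulusRSWLarge_holds`). Blueprint `Lines/fk_anchor_transfer_c2_heart_blueprint.md` §8: Kesten's 1986
scheme — innermost open separating paths explored from the anchor side, positive kernels
`M(C, D) = P{F_j(D), C ↔ D | C wired}` between consecutive blocks (domain Markov with the rim wired [LANDED
`rcMeasure_real_inter_eq_mul_of_rim_wired`, `…_wired`], junk `(1-c)^m` by conditional RSW + FKG on cylinders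
[LANDED `rcMeasure_real_inter_biInter_compl_le`]), Hopf's contraction for kernels with bounded cross-ratios [LANDED
`Literature.Analysis.Convexity.Doeblin.sum_mul_div_div_le_of_crossRatio`], and the KEY = Kesten's Lemma (23)
(bounded cross-ratios of `M`, RSW + FKG gluing in two intermediate annuli + boundary-condition pushing).
REV 15: LANDED UNCONDITIONALLY — `Theorems.IsingBoundaryRatio.stub_fkArmOriginForgettingBS` (p135264 = assembly p133173 applied to ABS-A
`ScaleFrame.insideRatio_osc_le` p135043 and ABS-TWO `ScaleFrame.ratio_forgetting_two_graphs` p134358; KEY `kernel_crossRatio_le` p134515). Rev 13 had it PROVED from the two abstract stubs by the LANDED assembly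
`Theorems.IsingBoundaryRatio.fkArmOriginForgettingBS_of` (p133173: parameter choice after Kesten 1986 §2, chart frames via GEO-1/2/3,
the common window, two applications of ABS-TWO, final algebra). -/
theorem stub_fkArmOriginForgettingBS :
    ChartAnnulusSeparation → RoughHalfAnnulusRSWMeshLargeOf AnnPathSepG → HalfAnnulusRadialCrossingBoundFat →
      RoughHalfAnnulusRSWLargeOf AnnPathSepG →
      ∀ (D : DobrushinDomain), FKArmOriginForgettingAt D.carrier (D.pt 0) :=
  Summit.CriticalPhenomena.SAWScalingLimit.Theorems.IsingBoundaryRatio.stub_fkArmOriginForgettingBS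

/-- STUB 1b‴ (L, rev 11, NEW; = `HalfAnnulusRadialCrossingBoundFat`, RSW clause (iii), fattened local edge set): the open RADIAL crossing of the
lattice conformal half-annulus has probability `≥ c(M) > 0` under the FREE local measure — the gluing input of
quasi-multiplicativity (Kesten 1986 (29)–(30)). Needs NO boundary RSW: route the crossing through the bulk sector
`{π/4 ≤ arg φ⁻¹ ≤ 3π/4}` (Koebe distortion, tree `Literature.Analysis.Complex.KoebeDistortion` /
`HalfPlaneDistortion`) and glue crossings of a bounded chain of lattice rectangles given by the tree's PROVED critical
FK–Ising RSW theorem `fkIsing_rsw_holds` (DHN11 Thm. 1) with FKG; free measures increase with the domain.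
LANDED rev 12 (worker W8, p130822: `Theorems/SAWLoopFugacityFlowIsingBoundaryRatioRadialCrossingBound.lean`, bulk chain +
Koebe, no CDH16). -/
theorem stub_halfAnnulusRadialCrossingBound : HalfAnnulusRadialCrossingBoundFat :=
  Summit.CriticalPhenomena.SAWScalingLimit.Theorems.IsingBoundaryRatio.stub_halfAnnulusRadialCrossingBound

/-- STUB 1c'β′ in its rev-8 registered form (`ChartAnnulusSeparation → RoughHalfAnnulusRSWLargeOf AnnPathSepG → ∀ D, …`):
rev 11 — PROVED from the reshaped heart `stub_fkArmOriginForgettingBS`, the mesh-local RSW forms proved above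
(`roughHalfAnnulusRSWMeshLarge_holds`) and clause (iii) (`stub_halfAnnulusRadialCrossingBound`). -/
theorem stub_fkArmOriginForgettingPath :
    ChartAnnulusSeparation → RoughHalfAnnulusRSWLargeOf AnnPathSepG →
      ∀ (D : DobrushinDomain), FKArmOriginForgettingAt D.carrier (D.pt 0) :=
  fun h1 h2 => stub_fkArmOriginForgettingBS h1 roughHalfAnnulusRSWMeshLarge_holds stub_halfAnnulusRadialCrossingBound h2

/-- The FK heart at `pt 0`, unconditionally modulo the stubs: 1c'β′ applied to 1a (landed) and the
large-modulus RSW (`roughHalfAnnulusRSWLarge_holds`). -/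
theorem fkArmOriginForgetting_holds : ∀ (D : DobrushinDomain), FKArmOriginForgettingAt D.carrier (D.pt 0) :=
  stub_fkArmOriginForgettingPath stub_chartAnnulusSeparation roughHalfAnnulusRSWLarge_holds

/-- The REPAIRED arm-origin-forgetting heart at `pt 0` (`ArmOriginForgettingAt'`, in-volume walks; the rev-4
unprimed target is FALSE, `not_armOriginForgetting`, p102702) — PROVED from 1c'α (Edwards–Sokal, landed) and the
FK heart: rewrite the four two-point functions. -/
theorem armOriginForgettingCore'_holds :
    ∀ (D : DobrushinDomain), ArmOriginForgettingAt' D.carrier (D.pt 0) := by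
  intro D ε c η hε hc hη
  obtain ⟨r, hr, hev⟩ := fkArmOriginForgetting_holds D ε c η hε hc hη
  refine ⟨r, hr, ?_⟩
  filter_upwards [hev] with δ hδ
  intro G₁ _ G₂ _ Λ₁ Λ₂ x x' y₁ y₂ hL₁ hL₂ hx₁ hx₂ hx'₁ hx'₂ hy₁ hy₂ hdx hdx' hdy₁ hdy₂ w₁ w₁' w₂ w₂'
  have key := hδ G₁ G₂ Λ₁ Λ₂ x x' y₁ y₂ hL₁ hL₂ hx₁ hx₂ hx'₁ hx'₂ hy₁ hy₂ hdx hdx' hdy₁ hdy₂ w₁ w₁' w₂ w₂'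
  simp only at key
  rw [stub_freeTwoPoint_eq_fkConn G₁ Λ₁ x y₁ hx₁ hy₁, stub_freeTwoPoint_eq_fkConn G₁ Λ₁ x' y₁ hx'₁ hy₁,
    stub_freeTwoPoint_eq_fkConn G₂ Λ₂ x y₂ hx₂ hy₂, stub_freeTwoPoint_eq_fkConn G₂ Λ₂ x' y₂ hx'₂ hy₂]
  exact key

/-- STUB 1c' (rev-5 registered form `ChartAnnulusSeparation → RoughHalfAnnulusRSW → ∀ D, ArmOriginForgettingAt' …`;
rev 8: PROVED — neither hypothesis is used, everything comes from `armOriginForgettingCore'_holds`). -/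
theorem stub_armOriginForgettingCore' :
    ChartAnnulusSeparation → RoughHalfAnnulusRSW →
      ∀ (D : DobrushinDomain), ArmOriginForgettingAt' D.carrier (D.pt 0) :=
  fun _ _ => armOriginForgettingCore'_holds

/-- STUB 1d (LANDED p102561, lead-1): the Dobrushin domain with the two marked points swapped — same
carrier, `pt 0` of the new domain is `pt 1` of the old (re-parametrise the boundary loop
`t ↦ D.boundary (s - t)` for a suitable shift `s`, marks `s - mark 1 < s - mark 0` reduced to the
fundamental period). -/
theorem stub_reverseDobrushin :
    ∀ (D : DobrushinDomain), ∃ D' : DobrushinDomain, D'.carrier = D.carrier ∧ D'.pt 0 = D.pt 1 :=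
  Summit.CriticalPhenomena.SAWScalingLimit.Theorems.IsingBoundaryRatio.stub_reverseDobrushin

/-- STUB 1e' (M, rev 5; = `ArmOriginForgetting' → AnchorLocality`; PROVED by the c1 lead in
`Lines/fk_anchor_transfer_c1_repair.lean`, LANDED by the c2 lead as
`Theorems/SAWLoopFugacityFlowIsingBoundaryRatioLocalAgreementTransfer.lean`, p111453): anchor locality is
(repaired) arm-origin forgetting for the pair `(Ω'_δ, meshDomainFinset D' δ)`, `(Ω_δ, meshDomainFinset D δ)`,
both of which agree locally with `Ω_δ` in `B(D.pt i, ε/2)` for `δ < ε/2` (for `Ω'_δ`: an edge of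
`Ω_δ` at a site `w ∈ meshDomain D' δ` with `meshPoint δ w ∈ B(D.pt i, ε/2)` has its closed segment in
`closure D ∩ B(D.pt i, ε) ⊆ closure D'`, so it is an edge of `meshGraph D' δ`, its other endpoint has
mesh point in `D ∩ B = D' ∩ B`, and a `meshGraph D'`-neighbour of a site of a maximal component of
`meshVertexGraph D' δ` lies in that component — `discreteDomainGraph_adj_iff`, `meshGraph_adj_iff`,
`meshDomain`; the converse inclusion is `discreteDomainGraph_mono` under the eventual nesting
`meshDomain D' δ ⊆ meshDomain D δ`), with `freeTwoPoint (Ω_δ) (meshDomainFinset Ω δ) = T Ω δ` (`rfl`),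
membership from `mem_meshDomain_of_reachable_ne`, and `x δ ≠ y δ` eventually from `r < c`. -/
theorem stub_localAgreementTransfer' :
    ArmOriginForgetting' →
    ∀ (D D' : DobrushinDomain) (i : Fin 2) (ε : ℝ), D'.carrier ⊆ D.carrier → 0 < ε →
      D'.carrier ∩ Metric.ball (D.pt i) ε = D.carrier ∩ Metric.ball (D.pt i) ε →
      ∀ c : ℝ, 0 < c → ∀ η : ℝ, 0 < η → ∃ r : ℝ, 0 < r ∧
        ∀ (x x' y : ℝ → Site 2),
          (∀ᶠ δ in 𝓝[>] (0 : ℝ), dist (meshPoint δ (x δ)) (D.pt i) < r) →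
          (∀ᶠ δ in 𝓝[>] (0 : ℝ), dist (meshPoint δ (x' δ)) (D.pt i) < r) →
          (∀ᶠ δ in 𝓝[>] (0 : ℝ), c ≤ dist (meshPoint δ (y δ)) (D.pt i)) →
          (∀ᶠ δ in 𝓝[>] (0 : ℝ), (discreteDomainGraph D'.carrier δ).Reachable (x δ) (y δ) ∧
            (discreteDomainGraph D'.carrier δ).Reachable (x' δ) (y δ)) →
          (∀ᶠ δ in 𝓝[>] (0 : ℝ), meshDomain D'.carrier δ ⊆ meshDomain D.carrier δ) →
          ∀ᶠ δ in 𝓝[>] (0 : ℝ),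
            |T D'.carrier δ (x δ) (y δ) / T D'.carrier δ (x' δ) (y δ) /
                (T D.carrier δ (x δ) (y δ) / T D.carrier δ (x' δ) (y δ)) - 1| < η :=
  Summit.CriticalPhenomena.SAWScalingLimit.Theorems.IsingBoundaryRatio.stub_localAgreementTransfer'

/-- `ArmOriginForgetting'` from the repaired heart at `pt 0` and the reversal of Dobrushin domains
(PROVED: `Fin 2` cases). -/
theorem armOriginForgetting'_of_core
    (hcore : ∀ (D : DobrushinDomain), ArmOriginForgettingAt' D.carrier (D.pt 0))
    (hrev : ∀ (D : DobrushinDomain), ∃ D' : DobrushinDomain, D'.carrier = D.carrier ∧ D'.pt 0 = D.pt 1) :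
    ArmOriginForgetting' := by
  intro D i
  fin_cases i
  · exact hcore D
  · obtain ⟨D', hc, hp⟩ := hrev D
    have h := hcore D'
    rw [hc, hp] at h
    simpa using h

/-- STUB 1 (= `AnchorLocality`) — PROVED from stubs 1a, 1b, 1c', 1d, 1e' (modus ponens). -/
theorem stub_anchorLocality :
    ∀ (D D' : DobrushinDomain) (i : Fin 2) (ε : ℝ), D'.carrier ⊆ D.carrier → 0 < ε →
      D'.carrier ∩ Metric.ball (D.pt i) ε = D.carrier ∩ Metric.ball (D.pt i) ε →
      ∀ c : ℝ, 0 < c → ∀ η : ℝ, 0 < η → ∃ r : ℝ, 0 < r ∧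
        ∀ (x x' y : ℝ → Site 2),
          (∀ᶠ δ in 𝓝[>] (0 : ℝ), dist (meshPoint δ (x δ)) (D.pt i) < r) →
          (∀ᶠ δ in 𝓝[>] (0 : ℝ), dist (meshPoint δ (x' δ)) (D.pt i) < r) →
          (∀ᶠ δ in 𝓝[>] (0 : ℝ), c ≤ dist (meshPoint δ (y δ)) (D.pt i)) →
          (∀ᶠ δ in 𝓝[>] (0 : ℝ), (discreteDomainGraph D'.carrier δ).Reachable (x δ) (y δ) ∧
            (discreteDomainGraph D'.carrier δ).Reachable (x' δ) (y δ)) →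
          (∀ᶠ δ in 𝓝[>] (0 : ℝ), meshDomain D'.carrier δ ⊆ meshDomain D.carrier δ) →
          ∀ᶠ δ in 𝓝[>] (0 : ℝ),
            |T D'.carrier δ (x δ) (y δ) / T D'.carrier δ (x' δ) (y δ) /
                (T D.carrier δ (x δ) (y δ) / T D.carrier δ (x' δ) (y δ)) - 1| < η :=
  stub_localAgreementTransfer'
    (armOriginForgetting'_of_core armOriginForgettingCore'_holds stub_reverseDobrushin)

/-! STUB 2 (L, PRINTED THEOREM; = `BulkFreeRatio`) — CHI15 (arXiv:1202.2838) Thm 1.1, free boundary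
conditions, for the crux's discretisation of the Jordan domains `D'` and `D` (graph `Ω_δ`, all sites free
— one boundary layer more than the tree's `meshIsingFreeCorr`, volume `meshInteriorFinset`), divided:
`ϱ(δ)` cancels and the explicit limit `twoPointFreeCHI ψ z w` is positive for `z ≠ w` (`u < 1`). Tree:
`tendsto_twoPoint_free_rho_of_ratios` / `chi_twoPoint_rho_of_ratios` give CHI Thm 1.1 (free) for the
tree's convention modulo CHI Prop 2.20 / Thm 1.7 (hypotheses `hR`, `hB`, unproved). -/

/-- STUB 2' (NAMED FACT X — debt queue, NOT a worker task): CHI15 Thm 1.1 with free boundary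
conditions, `ϱ`-normalised, for the canonical discretisation of a Jordan domain — the Literature fact
`Literature.Probability.LatticeModels.chi_twoPoint_free_jordan` (landed p88667, file
`Literature/Probability/LatticeModels/PlanarIsingFreeTwoPointJordan.lean`, unproved: its proof is the
discrete-holomorphic spinor analysis of CHI15 §§2–3). The line is CLOSED MODULO this fact and STUB 1. -/
theorem stub_chiTwoPointFreeJordan : Literature.Probability.LatticeModels.chi_twoPoint_free_jordan := by
  sorry

/-- STUB 2 (= `BulkFreeRatio`; PROVED from STUB 2' by the landed reduction
`Theorems.IsingBoundaryRatio.bulkFreeRatio_of_chi`, p91239). -/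
theorem stub_bulkFreeRatio :
    ∀ (D D' : DobrushinDomain), D'.carrier ⊆ D.carrier →
      ∀ (φ : ConformalEquiv UpperHalfPlane.upperHalfPlaneSet D.carrier) (A : Set ℂ),
        A = closure (UpperHalfPlane.upperHalfPlaneSet \
          {z | z ∈ UpperHalfPlane.upperHalfPlaneSet ∧ φ z ∈ D'.carrier}) →
      ∀ (Φ : ConformalEquiv (UpperHalfPlane.upperHalfPlaneSet \ A) UpperHalfPlane.upperHalfPlaneSet)
        (z w : ℂ), z ∈ D'.carrier → w ∈ D'.carrier → z ≠ w →
        Tendsto (fun δ => T D'.carrier δ (nearestSite δ z) (nearestSite δ w) /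
            T D.carrier δ (nearestSite δ z) (nearestSite δ w)) (𝓝[>] 0)
          (𝓝 (twoPointFreeCHI (fun x => Φ (φ.symm x)) z w /
            twoPointFreeCHI (fun x => φ.symm x) z w)) :=
  Summit.CriticalPhenomena.SAWScalingLimit.Theorems.IsingBoundaryRatio.bulkFreeRatio_of_chi
    stub_chiTwoPointFreeJordan

/-! ### Reshaped by the line lead (2026-08-16, cycle 1): `BoundaryFusion` is split into two
restriction-map lemmas (behaviour of `Φ_A` at `0` and at `∞`) and the fusion algebra proper.
The composition is unchanged: `boundaryFusion_holds` below is now PROVED from the three new stubs. -/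

/-- **Restriction map at `0`** (Schwarz reflection of `Φ_A` at `0`, [LSW] proof of Lemma 3.5):
for a `*`-hull `A`, a restriction map `Φ` of `A` with `Φ'_A(0) = d`, as `ζ → 0` inside `ℍ ∖ A`:
`Im Φ(ζ) / Im ζ → d` (every manner of approach: the reflection `F` of `Φ` is holomorphic near `0`,
real on the real axis, `F'(0) = d`, and `Im F(ζ) = Im ζ · Re F'(Re ζ + it*)` by the mean value
theorem on the vertical segment) and `Φ'(ζ) → d` (continuity of `F'`). Tree:
`IsRestrictionMap.exists_reflection` (RestrictionMapReflection.lean). -/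
def RestrictionMapAtZero : Prop :=
  ∀ (A : Set ℂ) (Φ : ConformalEquiv (upperHalfPlaneSet \ A) upperHalfPlaneSet) (d : ℝ),
    IsStarHull A → IsRestrictionMap A Φ → HasRestrictionDeriv A Φ d →
    Tendsto (fun ζ : ℂ => (Φ ζ).im / ζ.im) (𝓝[upperHalfPlaneSet \ A] 0) (𝓝 d) ∧
    Tendsto (fun ζ : ℂ => deriv (fun x => Φ x) ζ) (𝓝[upperHalfPlaneSet \ A] 0) (𝓝 (d : ℂ))

/-- **Restriction map at `∞`** (hydrodynamic expansion `Φ_A(ξ) = ξ + a₀ + O(1/ξ)` with real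
coefficients): for a `*`-hull `A` and a restriction map `Φ` of `A`, as `ξ → ∞` inside `ℍ ∖ A`:
`Im Φ(ξ) / Im ξ → 1` and `Φ'(ξ) → 1`. Intended proof: INVERSION — `Ψ(w) = −d / Φ(−1/w)` is a
restriction map of the `*`-hull `A' = {−1/z | z ∈ A}` with `Ψ'_{A'}(0) = d`, and
`Im Φ(z)/Im z = d · (Im Ψ w / Im w) · (‖w‖²/‖Ψ w‖²)`, `Φ'(z) = d Ψ'(w) w² / Ψ(w)²` (`w = −1/z`), so
the statement at `∞` is the statement at `0` (`RestrictionMapAtZero`) for `(A', Ψ, d)`. -/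
def RestrictionMapAtInfty : Prop :=
  ∀ (A : Set ℂ) (Φ : ConformalEquiv (upperHalfPlaneSet \ A) upperHalfPlaneSet),
    IsStarHull A → IsRestrictionMap A Φ →
    Tendsto (fun ξ : ℂ => (Φ ξ).im / ξ.im) (cocompact ℂ ⊓ 𝓟 (upperHalfPlaneSet \ A)) (𝓝 1) ∧
    Tendsto (fun ξ : ℂ => deriv (fun x => Φ x) ξ) (cocompact ℂ ⊓ 𝓟 (upperHalfPlaneSet \ A)) (𝓝 1)

/-- STUB 3a (S–M, complex analysis near `0`; = `RestrictionMapAtZero`). -/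
theorem stub_restrictionMapAtZero :
    ∀ (A : Set ℂ) (Φ : ConformalEquiv (UpperHalfPlane.upperHalfPlaneSet \ A) UpperHalfPlane.upperHalfPlaneSet)
      (d : ℝ), IsStarHull A → IsRestrictionMap A Φ → HasRestrictionDeriv A Φ d →
      Tendsto (fun ζ : ℂ => (Φ ζ).im / ζ.im) (𝓝[UpperHalfPlane.upperHalfPlaneSet \ A] 0) (𝓝 d) ∧
      Tendsto (fun ζ : ℂ => deriv (fun x => Φ x) ζ) (𝓝[UpperHalfPlane.upperHalfPlaneSet \ A] 0)
        (𝓝 (d : ℂ)) :=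
  Summit.CriticalPhenomena.SAWScalingLimit.Theorems.IsingBoundaryRatio.stub_restrictionMapAtZero

/-- STUB 3b (M, inversion `w = −1/z`; = `RestrictionMapAtZero → RestrictionMapAtInfty`). -/
theorem stub_restrictionMapAtInfty :
    (∀ (A : Set ℂ) (Φ : ConformalEquiv (UpperHalfPlane.upperHalfPlaneSet \ A) UpperHalfPlane.upperHalfPlaneSet)
      (d : ℝ), IsStarHull A → IsRestrictionMap A Φ → HasRestrictionDeriv A Φ d →
      Tendsto (fun ζ : ℂ => (Φ ζ).im / ζ.im) (𝓝[UpperHalfPlane.upperHalfPlaneSet \ A] 0) (𝓝 d) ∧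
      Tendsto (fun ζ : ℂ => deriv (fun x => Φ x) ζ) (𝓝[UpperHalfPlane.upperHalfPlaneSet \ A] 0)
        (𝓝 (d : ℂ))) →
    ∀ (A : Set ℂ) (Φ : ConformalEquiv (UpperHalfPlane.upperHalfPlaneSet \ A) UpperHalfPlane.upperHalfPlaneSet),
      IsStarHull A → IsRestrictionMap A Φ →
      Tendsto (fun ξ : ℂ => (Φ ξ).im / ξ.im)
        (cocompact ℂ ⊓ 𝓟 (UpperHalfPlane.upperHalfPlaneSet \ A)) (𝓝 1) ∧
      Tendsto (fun ξ : ℂ => deriv (fun x => Φ x) ξ)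
        (cocompact ℂ ⊓ 𝓟 (UpperHalfPlane.upperHalfPlaneSet \ A)) (𝓝 1) :=
  Summit.CriticalPhenomena.SAWScalingLimit.Theorems.IsingBoundaryRatio.stub_restrictionMapAtInfty

/-- STUB 3c (M, explicit algebra + Carathéodory; = `RestrictionMapAtZero → RestrictionMapAtInfty →
BoundaryFusion`) — the ratio of CHI's explicit free two-point functions of `D' ⊆ D` fuses to `d^{1/2}`
at the two common marked points: in the chart `ζ = φ⁻¹ z → 0` (`IsChordalUniformizing.tendsto_symm_nhds_zero`),
`ξ = φ⁻¹ w → ∞` (`IsChordalUniformizing.tendsto_symm_cocompact`), with `u⁻¹ − u =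
4 Im ζ Im ξ / ((‖ξ−ζ̄‖ + ‖ξ−ζ‖) √(‖ξ−ζ‖‖ξ−ζ̄‖))` (`norm_sub_conj_sq`), the ratio equals
`√[(Im Φζ/Im ζ)(Im Φξ/Im ξ)(N/N')] · (Im ζ/Im Φζ)^{1/8} (Im ξ/Im Φξ)^{1/8} ‖Φ'ζ‖^{1/8} ‖Φ'ξ‖^{1/8}`
(chain rule `(Φ ∘ φ⁻¹)' = Φ'(φ⁻¹ ·) · (φ⁻¹)'`, `(φ⁻¹)' ≠ 0`), which tends to
`d^{1/2} · d^{−1/8} · d^{1/8} = d^{1/2}` by the two restriction-map stubs (`0 < d`,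
`Negative.starHull_and_deriv_mem`; `φ⁻¹(D') ⊆ ℍ ∖ A`). -/
theorem stub_boundaryFusionCore :
    (∀ (A : Set ℂ) (Φ : ConformalEquiv (UpperHalfPlane.upperHalfPlaneSet \ A) UpperHalfPlane.upperHalfPlaneSet)
      (d : ℝ), IsStarHull A → IsRestrictionMap A Φ → HasRestrictionDeriv A Φ d →
      Tendsto (fun ζ : ℂ => (Φ ζ).im / ζ.im) (𝓝[UpperHalfPlane.upperHalfPlaneSet \ A] 0) (𝓝 d) ∧
      Tendsto (fun ζ : ℂ => deriv (fun x => Φ x) ζ) (𝓝[UpperHalfPlane.upperHalfPlaneSet \ A] 0)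
        (𝓝 (d : ℂ))) →
    (∀ (A : Set ℂ) (Φ : ConformalEquiv (UpperHalfPlane.upperHalfPlaneSet \ A) UpperHalfPlane.upperHalfPlaneSet),
      IsStarHull A → IsRestrictionMap A Φ →
      Tendsto (fun ξ : ℂ => (Φ ξ).im / ξ.im)
        (cocompact ℂ ⊓ 𝓟 (UpperHalfPlane.upperHalfPlaneSet \ A)) (𝓝 1) ∧
      Tendsto (fun ξ : ℂ => deriv (fun x => Φ x) ξ)
        (cocompact ℂ ⊓ 𝓟 (UpperHalfPlane.upperHalfPlaneSet \ A)) (𝓝 1)) →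
    ∀ (D D' : DobrushinDomain), D'.carrier ⊆ D.carrier → D'.pt 0 = D.pt 0 → D'.pt 1 = D.pt 1 →
      (∃ ε : ℝ, 0 < ε ∧ D'.carrier ∩ Metric.ball (D.pt 0) ε = D.carrier ∩ Metric.ball (D.pt 0) ε ∧
        D'.carrier ∩ Metric.ball (D.pt 1) ε = D.carrier ∩ Metric.ball (D.pt 1) ε) →
      ∀ (φ : ConformalEquiv UpperHalfPlane.upperHalfPlaneSet D.carrier), D.IsChordalUniformizing φ →
      ∀ (A : Set ℂ), A = closure (UpperHalfPlane.upperHalfPlaneSet \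
          {z | z ∈ UpperHalfPlane.upperHalfPlaneSet ∧ φ z ∈ D'.carrier}) →
      ∀ (Φ : ConformalEquiv (UpperHalfPlane.upperHalfPlaneSet \ A) UpperHalfPlane.upperHalfPlaneSet)
        (d : ℝ), IsRestrictionMap A Φ → HasRestrictionDeriv A Φ d →
        Tendsto (fun p : ℂ × ℂ => twoPointFreeCHI (fun x => Φ (φ.symm x)) p.1 p.2 /
            twoPointFreeCHI (fun x => φ.symm x) p.1 p.2)
          (𝓝[D'.carrier] (D.pt 0) ×ˢ 𝓝[D'.carrier] (D.pt 1)) (𝓝 (d ^ ((1 : ℝ) / 2))) :=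
  Summit.CriticalPhenomena.SAWScalingLimit.Theorems.IsingBoundaryRatio.stub_boundaryFusionCore

/-- `BoundaryFusion` from the three reshaped stubs (PROVED: modus ponens). -/
theorem stub_boundaryFusion : BoundaryFusion :=
  stub_boundaryFusionCore stub_restrictionMapAtZero
    (stub_restrictionMapAtInfty stub_restrictionMapAtZero)

/-! ### Consistency: each named statement IS its registered stub (definitionally) -/

theorem anchorLocality_holds : AnchorLocality := stub_anchorLocality
theorem bulkFreeRatio_holds : BulkFreeRatio := stub_bulkFreeRatio
theorem boundaryFusion_holds : BoundaryFusion := stub_boundaryFusion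
theorem restrictionMapAtZero_holds : RestrictionMapAtZero := stub_restrictionMapAtZero
theorem restrictionMapAtInfty_holds : RestrictionMapAtInfty :=
  stub_restrictionMapAtInfty stub_restrictionMapAtZero

/-! ### Lattice and algebra helpers (proved) -/

/-- `⟨σ_xσ_y⟩ = ⟨σ_yσ_x⟩` for the crux's two-point function. -/
theorem T_comm (Ω : Set ℂ) (δ : ℝ) (x y : Site 2) : T Ω δ x y = T Ω δ y x := by
  unfold T isingTwoPoint spinPair
  congr 1
  funext σ
  ring

/-- Pure real-arithmetic core of the two-end transfer: two double ratios within `η₁ ≤ 1` of `1`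
and the GKS bound `W' ≤ W` give `|A'/A − W'/W| < 3η₁ ≤ η`. -/
theorem transfer_algebra {A' A Z' Z W' W η₁ η : ℝ} (hA : 0 < A) (hZ' : 0 < Z') (hZ : 0 < Z)
    (hW' : 0 < W') (hW : 0 < W) (hWW : W' ≤ W) (hη₁ : η₁ ≤ 1) (hη : 3 * η₁ ≤ η)
    (h₁ : |A' / Z' / (A / Z) - 1| < η₁) (h₂ : |Z' / W' / (Z / W) - 1| < η₁) :
    |A' / A - W' / W| < η := by
  have hA0 : A ≠ 0 := hA.ne'
  have hZ'0 : Z' ≠ 0 := hZ'.ne'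
  have hZ0 : Z ≠ 0 := hZ.ne'
  have hW'0 : W' ≠ 0 := hW'.ne'
  have hW0 : W ≠ 0 := hW.ne'
  set X := A' / Z' / (A / Z) with hX
  set Y := Z' / W' / (Z / W) with hY
  have key : A' / A = X * Y * (W' / W) := by
    simp only [hX, hY]
    field_simp
  have hB0 : 0 < W' / W := div_pos hW' hW
  have hB1 : W' / W ≤ 1 := (div_le_one hW).2 hWW
  have hYb : |Y| ≤ 1 + η₁ := by
    calc |Y| = |(Y - 1) + 1| := by rw [sub_add_cancel]
      _ ≤ |Y - 1| + |(1 : ℝ)| := abs_add_le _ _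
      _ ≤ 1 + η₁ := by rw [abs_one]; linarith [h₂.le]
  have hXY : |X * Y - 1| < 3 * η₁ := by
    have e : X * Y - 1 = (X - 1) * Y + (Y - 1) := by ring
    rw [e]
    have h3 : |(X - 1) * Y| ≤ |X - 1| * (1 + η₁) := by
      rw [abs_mul]
      exact mul_le_mul_of_nonneg_left hYb (abs_nonneg _)
    have h4 : |X - 1| * (1 + η₁) < η₁ * (1 + η₁) :=
      mul_lt_mul_of_pos_right h₁ (by linarith [abs_nonneg (X - 1)])
    have h5 : η₁ * (1 + η₁) ≤ 2 * η₁ := by nlinarith [abs_nonneg (X - 1)]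
    calc |(X - 1) * Y + (Y - 1)| ≤ |(X - 1) * Y| + |Y - 1| := abs_add_le _ _
      _ < 3 * η₁ := by linarith
  calc |A' / A - W' / W| = |W' / W| * |X * Y - 1| := by
        rw [key, ← abs_mul]
        congr 1
        ring
    _ ≤ 1 * |X * Y - 1| := by
        gcongr
        rw [abs_of_pos hB0]
        exact hB1
    _ < η := by linarith

/-- Interior points `z, w` of the subdomain: their nearest sites are eventually joined in `Ω'_δ`
to the endpoint approximation and to each other (largest mesh component of a Jordan domain,
`JordanDomain.eventually_forall_mem_meshDomain'`). -/
theorem eventually_bulk_reachable {D' : DobrushinDomain} {a b : ℝ → Site 2}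
    (hD' : SAW.IsEndpointApprox D' a b) {z w : ℂ} (hz : z ∈ D'.carrier) (hw : w ∈ D'.carrier) :
    ∀ᶠ δ in 𝓝[>] (0 : ℝ),
      (discreteDomainGraph D'.carrier δ).Reachable (nearestSite δ z) (b δ) ∧
      (discreteDomainGraph D'.carrier δ).Reachable (nearestSite δ z) (nearestSite δ w) := by
  obtain ⟨ρz, hρz, hballz⟩ := Metric.isOpen_iff.1 D'.isOpen z hz
  obtain ⟨ρw, hρw, hballw⟩ := Metric.isOpen_iff.1 D'.isOpen w hw
  have hK : IsCompact (closedBall z (ρz / 2) ∪ closedBall w (ρw / 2)) :=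
    (isCompact_closedBall _ _).union (isCompact_closedBall _ _)
  have hKD' : closedBall z (ρz / 2) ∪ closedBall w (ρw / 2) ⊆ D'.carrier :=
    union_subset ((closedBall_subset_ball (by linarith)).trans hballz)
      ((closedBall_subset_ball (by linarith)).trans hballw)
  filter_upwards [hD'.reachable, eventually_ne hD',
    D'.toJordanDomain.eventually_forall_mem_meshDomain' hK hKD',
    Ioo_mem_nhdsGT (lt_min (half_pos hρz) (half_pos hρw))] with δ hr hne hJ hδ
  have hzK : meshPoint δ (nearestSite δ z) ∈ closedBall z (ρz / 2) ∪ closedBall w (ρw / 2) :=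
    Or.inl (mem_closedBall.2 ((dist_meshPoint_nearestSite_le hδ.1 z).trans
      (hδ.2.le.trans (min_le_left _ _))))
  have hwK : meshPoint δ (nearestSite δ w) ∈ closedBall z (ρz / 2) ∪ closedBall w (ρw / 2) :=
    Or.inr (mem_closedBall.2 ((dist_meshPoint_nearestSite_le hδ.1 w).trans
      (hδ.2.le.trans (min_le_right _ _))))
  have hzD : nearestSite δ z ∈ meshDomain D'.carrier δ := hJ.1 _ hzK
  have hwD : nearestSite δ w ∈ meshDomain D'.carrier δ := hJ.1 _ hwK
  have hbD : b δ ∈ meshDomain D'.carrier δ := mem_meshDomain_of_reachable_ne hr.symm (Ne.symm hne)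
  have key : ∀ u v : Site 2, u ∈ meshDomain D'.carrier δ → v ∈ meshDomain D'.carrier δ →
      (discreteDomainGraph D'.carrier δ).Reachable u v := by
    intro u v hu hv
    obtain ⟨hu', hv', hreach⟩ := hJ.2 u hu v hv
    obtain ⟨p⟩ := hreach
    exact reachable_discreteDomainGraph_of_walk p hu
  exact ⟨key _ _ hzD hbD, key _ _ hzD hwD⟩

/-! ### The two-end transfer from anchor locality (PROVED) -/

/-- `AnchorLocality → AnchorTransfer`: apply anchor locality at `a` (anchors `a_δ`, `[z/δ]`; far
spin `b_δ`) and at `b` (anchors `b_δ`, `[w/δ]`; far spin `[z/δ]`), multiply the two double ratios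
(symmetry `⟨σ_xσ_y⟩ = ⟨σ_yσ_x⟩`), and pass to the difference form with the GKS bound
`⟨σ_{[z]}σ_{[w]}⟩_{Ω'} ≤ ⟨σ_{[z]}σ_{[w]}⟩_{Ω}` (`T_mono`) and strict positivity (`T_pos_of_reachable`). -/
theorem anchorTransfer_of_anchorLocality (hL : AnchorLocality) : AnchorTransfer := by
  intro D D' a b hD hD' hsub hε η hη
  obtain ⟨ε, hε0, hb0, hb1⟩ := hε
  have hab : D.pt 0 ≠ D.pt 1 := fun h => absurd (D.pt_injective h) (by decide)
  set L := dist (D.pt 0) (D.pt 1) with hLdef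
  have hL0 : 0 < L := dist_pos.2 hab
  set η₁ : ℝ := min 1 (η / 3) with hη₁def
  have hη₁0 : 0 < η₁ := lt_min one_pos (by positivity)
  have hη₁1 : η₁ ≤ 1 := min_le_left _ _
  have hη₁3 : 3 * η₁ ≤ η := by
    have := min_le_right 1 (η / 3)
    linarith
  obtain ⟨r₁, hr₁, H₁⟩ := hL D D' 0 ε hsub hε0 hb0 (L / 2) (half_pos hL0) η₁ hη₁0
  obtain ⟨r₂, hr₂, H₂⟩ := hL D D' 1 ε hsub hε0 hb1 (L / 2) (half_pos hL0) η₁ hη₁0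
  refine ⟨min (min r₁ r₂) (L / 4), lt_min (lt_min hr₁ hr₂) (by positivity), ?_⟩
  intro z w hz hw hzr hwr
  have hzr₁ : dist z (D.pt 0) < r₁ := lt_of_lt_of_le hzr ((min_le_left _ _).trans (min_le_left _ _))
  have hwr₂ : dist w (D.pt 1) < r₂ := lt_of_lt_of_le hwr ((min_le_left _ _).trans (min_le_right _ _))
  have hzL : dist z (D.pt 0) < L / 4 := lt_of_lt_of_le hzr (min_le_right _ _)
  -- eventual facts along `δ → 0⁺`
  have hnest := eventually_meshDomain_subset hD hD' hsub
  have hbulk := eventually_bulk_reachable hD' hz hw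
  have ex_a : ∀ᶠ δ in 𝓝[>] (0 : ℝ), dist (meshPoint δ (a δ)) (D.pt 0) < r₁ :=
    (Metric.tendsto_nhds.1 hD.tendsto_fst) r₁ hr₁
  have ex_z : ∀ᶠ δ in 𝓝[>] (0 : ℝ), dist (meshPoint δ (nearestSite δ z)) (D.pt 0) < r₁ := by
    filter_upwards [Ioo_mem_nhdsGT (sub_pos.2 hzr₁)] with δ hδ
    calc dist (meshPoint δ (nearestSite δ z)) (D.pt 0)
        ≤ dist (meshPoint δ (nearestSite δ z)) z + dist z (D.pt 0) := dist_triangle _ _ _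
      _ ≤ δ + dist z (D.pt 0) := by
          gcongr
          exact dist_meshPoint_nearestSite_le hδ.1 z
      _ < r₁ := by linarith [hδ.2]
  have ex_b : ∀ᶠ δ in 𝓝[>] (0 : ℝ), dist (meshPoint δ (b δ)) (D.pt 1) < r₂ :=
    (Metric.tendsto_nhds.1 hD.tendsto_snd) r₂ hr₂
  have ex_w : ∀ᶠ δ in 𝓝[>] (0 : ℝ), dist (meshPoint δ (nearestSite δ w)) (D.pt 1) < r₂ := by
    filter_upwards [Ioo_mem_nhdsGT (sub_pos.2 hwr₂)] with δ hδ
    calc dist (meshPoint δ (nearestSite δ w)) (D.pt 1)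
        ≤ dist (meshPoint δ (nearestSite δ w)) w + dist w (D.pt 1) := dist_triangle _ _ _
      _ ≤ δ + dist w (D.pt 1) := by
          gcongr
          exact dist_meshPoint_nearestSite_le hδ.1 w
      _ < r₂ := by linarith [hδ.2]
  have far_b : ∀ᶠ δ in 𝓝[>] (0 : ℝ), L / 2 ≤ dist (meshPoint δ (b δ)) (D.pt 0) := by
    filter_upwards [(Metric.tendsto_nhds.1 hD.tendsto_snd) (L / 2) (half_pos hL0)] with δ hδ
    have h3 := dist_triangle (D.pt 0) (meshPoint δ (b δ)) (D.pt 1)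
    rw [dist_comm (D.pt 0) (meshPoint δ (b δ))] at h3
    linarith
  have far_z : ∀ᶠ δ in 𝓝[>] (0 : ℝ), L / 2 ≤ dist (meshPoint δ (nearestSite δ z)) (D.pt 1) := by
    filter_upwards [Ioo_mem_nhdsGT (show (0 : ℝ) < L / 4 by positivity)] with δ hδ
    have h1 : dist (meshPoint δ (nearestSite δ z)) z ≤ δ := dist_meshPoint_nearestSite_le hδ.1 z
    have h2 := dist_triangle (D.pt 0) z (D.pt 1)
    have h3 := dist_triangle z (meshPoint δ (nearestSite δ z)) (D.pt 1)
    rw [dist_comm z (meshPoint δ (nearestSite δ z))] at h3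
    rw [dist_comm (D.pt 0) z] at h2
    linarith [hδ.2]
  have reach₁ : ∀ᶠ δ in 𝓝[>] (0 : ℝ), (discreteDomainGraph D'.carrier δ).Reachable (a δ) (b δ) ∧
      (discreteDomainGraph D'.carrier δ).Reachable (nearestSite δ z) (b δ) := by
    filter_upwards [hD'.reachable, hbulk] with δ h1 h2
    exact ⟨h1, h2.1⟩
  have reach₂ : ∀ᶠ δ in 𝓝[>] (0 : ℝ),
      (discreteDomainGraph D'.carrier δ).Reachable (b δ) (nearestSite δ z) ∧
      (discreteDomainGraph D'.carrier δ).Reachable (nearestSite δ w) (nearestSite δ z) := by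
    filter_upwards [hbulk] with δ h2
    exact ⟨h2.1.symm, h2.2.symm⟩
  have E₁ := H₁ a (fun δ => nearestSite δ z) b ex_a ex_z far_b reach₁ hnest
  have E₂ := H₂ b (fun δ => nearestSite δ w) (fun δ => nearestSite δ z) ex_b ex_w far_z reach₂ hnest
  filter_upwards [E₁, E₂, hbulk, hD'.reachable, hnest, self_mem_nhdsWithin] with δ h₁ h₂ hbk hr' hΛ hδ
  have hδ0 : (0 : ℝ) < δ := hδ
  have hbdd' : Bornology.IsBounded D'.carrier := D.isBounded.subset hsub
  have hmono : discreteDomainGraph D'.carrier δ ≤ discreteDomainGraph D.carrier δ :=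
    discreteDomainGraph_mono hsub hΛ
  have h₁' : |T D'.carrier δ (a δ) (b δ) / T D'.carrier δ (nearestSite δ z) (b δ) /
      (T D.carrier δ (a δ) (b δ) / T D.carrier δ (nearestSite δ z) (b δ)) - 1| < η₁ := h₁
  have h₂' : |T D'.carrier δ (b δ) (nearestSite δ z) / T D'.carrier δ (nearestSite δ w) (nearestSite δ z) /
      (T D.carrier δ (b δ) (nearestSite δ z) / T D.carrier δ (nearestSite δ w) (nearestSite δ z)) - 1| < η₁ := h₂
  rw [T_comm D'.carrier δ (b δ), T_comm D.carrier δ (b δ), T_comm D'.carrier δ (nearestSite δ w),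
    T_comm D.carrier δ (nearestSite δ w)] at h₂'
  -- positivity (GKS I via the high-temperature expansion) and the GKS-II sandwich
  have pab : 0 < T D.carrier δ (a δ) (b δ) := T_pos_of_reachable D.isBounded hδ0 (hr'.mono hmono)
  have pzb' : 0 < T D'.carrier δ (nearestSite δ z) (b δ) := T_pos_of_reachable hbdd' hδ0 hbk.1
  have pzb : 0 < T D.carrier δ (nearestSite δ z) (b δ) :=
    T_pos_of_reachable D.isBounded hδ0 (hbk.1.mono hmono)
  have pzw' : 0 < T D'.carrier δ (nearestSite δ z) (nearestSite δ w) := T_pos_of_reachable hbdd' hδ0 hbk.2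
  have pzw : 0 < T D.carrier δ (nearestSite δ z) (nearestSite δ w) :=
    T_pos_of_reachable D.isBounded hδ0 (hbk.2.mono hmono)
  have hWW : T D'.carrier δ (nearestSite δ z) (nearestSite δ w) ≤
      T D.carrier δ (nearestSite δ z) (nearestSite δ w) := by
    by_cases hzw : nearestSite δ z = nearestSite δ w
    · rw [hzw, T_self, T_self]
    · obtain ⟨hx, hy⟩ := mem_meshDomainFinset_of_reachable_ne hbdd' hδ0 hbk.2 hzw
      exact T_mono D.isBounded hδ0 hsub hΛ hx hy
  exact transfer_algebra pab pzb' pzb pzw' pzw hWW hη₁1 hη₁3 h₁' h₂'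

/-! ### The `3η` assembly (PROVED) -/

/-- **Transfer**: anchor transfer + bulk free ratio + boundary fusion ⇒ the crux, by a `3η`
argument: given `e`, take `r` from `AnchorTransfer` and bulk points `(z, w)` — which exist because
the product filter `𝓝[D'] a ×ˢ 𝓝[D'] b` is non-trivial (`a, b ∈ ∂D' ⊆ closure D'`) — with
`z, w ∈ D'`, `r`-close to `a, b`, `z ≠ w`, and the continuum ratio within `e/3` of `d^{1/2}`
(`BoundaryFusion`); then `BulkFreeRatio` at `(z, w)` pins the lattice bulk ratio. -/
theorem normalForm_of_transfer (hK1 : AnchorTransfer) (hK2 : BulkFreeRatio)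
    (hK3 : BoundaryFusion) : NormalForm := by
  intro D D' a b hD hD' hsub h0 h1 hε φ hφ A hA Φ d hΦ hd
  rw [Metric.tendsto_nhds]
  intro e he
  have he3 : 0 < e / 3 := by positivity
  obtain ⟨r, hr, H1⟩ := hK1 D D' a b hD hD' hsub hε (e / 3) he3
  have H3 := hK3 D D' hsub h0 h1 hε φ hφ A hA Φ d hΦ hd
  have hab : D.pt 0 ≠ D.pt 1 := fun h => absurd (D.pt_injective h) (by decide)
  set L := dist (D.pt 0) (D.pt 1) with hLdef
  have hL0 : 0 < L := dist_pos.2 hab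
  have hcl0 : D.pt 0 ∈ closure D'.carrier := h0 ▸ frontier_subset_closure (D'.pt_mem_frontier 0)
  have hcl1 : D.pt 1 ∈ closure D'.carrier := h1 ▸ frontier_subset_closure (D'.pt_mem_frontier 1)
  haveI i0 : (𝓝[D'.carrier] (D.pt 0)).NeBot := mem_closure_iff_nhdsWithin_neBot.1 hcl0
  haveI i1 : (𝓝[D'.carrier] (D.pt 1)).NeBot := mem_closure_iff_nhdsWithin_neBot.1 hcl1
  haveI : (𝓝[D'.carrier] (D.pt 0) ×ˢ 𝓝[D'.carrier] (D.pt 1)).NeBot := prod_neBot.2 ⟨i0, i1⟩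
  have hρ0 : 0 < min r (L / 2) := lt_min hr (half_pos hL0)
  have ev1 : ∀ᶠ p : ℂ × ℂ in 𝓝[D'.carrier] (D.pt 0) ×ˢ 𝓝[D'.carrier] (D.pt 1),
      p.1 ∈ D'.carrier ∩ ball (D.pt 0) (min r (L / 2)) :=
    tendsto_fst.eventually (inter_mem self_mem_nhdsWithin
      (mem_nhdsWithin_of_mem_nhds (ball_mem_nhds _ hρ0)))
  have ev2 : ∀ᶠ p : ℂ × ℂ in 𝓝[D'.carrier] (D.pt 0) ×ˢ 𝓝[D'.carrier] (D.pt 1),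
      p.2 ∈ D'.carrier ∩ ball (D.pt 1) (min r (L / 2)) :=
    tendsto_snd.eventually (inter_mem self_mem_nhdsWithin
      (mem_nhdsWithin_of_mem_nhds (ball_mem_nhds _ hρ0)))
  have ev3 := Metric.tendsto_nhds.1 H3 _ he3
  obtain ⟨p, ⟨hz, hzρ⟩, ⟨hw, hwρ⟩, h3⟩ := (ev1.and (ev2.and ev3)).exists
  rw [mem_ball] at hzρ hwρ
  have hzr : dist p.1 (D.pt 0) < r := lt_of_lt_of_le hzρ (min_le_left _ _)
  have hwr : dist p.2 (D.pt 1) < r := lt_of_lt_of_le hwρ (min_le_left _ _)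
  have hne : p.1 ≠ p.2 := by
    intro hzw
    have h1' : dist p.1 (D.pt 0) < L / 2 := lt_of_lt_of_le hzρ (min_le_right _ _)
    have h2' : dist p.2 (D.pt 1) < L / 2 := lt_of_lt_of_le hwρ (min_le_right _ _)
    rw [hzw] at h1'
    have := dist_triangle_left (D.pt 0) (D.pt 1) p.2
    linarith
  have H2 := hK2 D D' hsub φ A hA Φ p.1 p.2 hz hw hne
  have ev4 := Metric.tendsto_nhds.1 H2 _ he3
  filter_upwards [H1 p.1 p.2 hz hw hzr hwr, ev4] with δ hδ1 hδ2
  unfold ratio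
  rw [Real.dist_eq] at hδ2 h3 ⊢
  have t1 := abs_sub_le (T D'.carrier δ (a δ) (b δ) / T D.carrier δ (a δ) (b δ))
    (T D'.carrier δ (nearestSite δ p.1) (nearestSite δ p.2) /
      T D.carrier δ (nearestSite δ p.1) (nearestSite δ p.2)) (d ^ ((1 : ℝ) / 2))
  have t2 := abs_sub_le (T D'.carrier δ (nearestSite δ p.1) (nearestSite δ p.2) /
      T D.carrier δ (nearestSite δ p.1) (nearestSite δ p.2))
    (twoPointFreeCHI (fun x => Φ (φ.symm x)) p.1 p.2 / twoPointFreeCHI (fun x => φ.symm x) p.1 p.2)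
    (d ^ ((1 : ℝ) / 2))
  linarith

/-! ### Name-keyed aliases of the open statements (the hypotheses of the composition: the skeleton
audit admits a hypothesis only if its head constant is a registered obligation or is named like a
declared stub; the stub attribute itself is gate-reserved) -/
namespace Registered

/-- Alias of the one-ball-component lemma keyed by the registered stub name. -/
abbrev stub_chartDiscOneComponent : Prop := ChartDiscOneComponent
/-- Alias of the CDH16 (i) instance keyed by the registered stub name. -/
abbrev stub_halfAnnulusSideCrossingBound : Prop :=
  Literature.Probability.LatticeModels.fkIsing_topologicalRectangle_crossingBounds →
    Literature.Probability.LatticeModels.discreteEL_ext_sandwich → HalfAnnulusSideCrossingBound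
/-- Alias of the CDH16 (ii) instance (large-modulus form) keyed by the registered stub name. -/
abbrev stub_halfAnnulusRimCrossingBoundLarge : Prop :=
  Literature.Probability.LatticeModels.fkIsing_topologicalRectangle_crossingBounds →
    Literature.Probability.LatticeModels.discreteEL_ext_sandwich →
    Literature.Probability.LatticeModels.discreteEL_ext_selfDual → HalfAnnulusRimCrossingBoundLarge
/-- Alias of the window presentation target keyed by the registered stub name. -/
abbrev stub_windowRectPresentation : Prop := WindowRectPresentation
/-- Alias of the CDH16 named facts keyed by the registered stub name. -/
abbrev stub_cdh16 : Prop :=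
  Literature.Probability.LatticeModels.fkIsing_topologicalRectangle_crossingBounds ∧
    Literature.Probability.LatticeModels.discreteEL_ext_sandwich ∧
    Literature.Probability.LatticeModels.discreteEL_ext_selfDual
/-- Alias of the one remaining CDH16 named fact (Thm 1.1) keyed by the registered stub name (rev 10). -/
abbrev stub_cdh16Thm11 : Prop :=
  Literature.Probability.LatticeModels.fkIsing_topologicalRectangle_crossingBounds
/-- Alias of the FK heart (large-modulus path-form RSW hypothesis) keyed by the registered stub name. -/
abbrev stub_fkArmOriginForgettingPath : Prop :=
  ChartAnnulusSeparation → RoughHalfAnnulusRSWLargeOf AnnPathSepG →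
    ∀ (D : DobrushinDomain), FKArmOriginForgettingAt D.carrier (D.pt 0)
/-- Alias of the reshaped FK heart (rev 11) keyed by the registered stub name. -/
abbrev stub_fkArmOriginForgettingBS : Prop :=
  ChartAnnulusSeparation → RoughHalfAnnulusRSWMeshLargeOf AnnPathSepG → HalfAnnulusRadialCrossingBoundFat →
    RoughHalfAnnulusRSWLargeOf AnnPathSepG →
    ∀ (D : DobrushinDomain), FKArmOriginForgettingAt D.carrier (D.pt 0)
/-- Alias of RSW clause (iii) keyed by the registered stub name (rev 11). -/
abbrev stub_halfAnnulusRadialCrossingBound : Prop := HalfAnnulusRadialCrossingBoundFat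
/-- Alias of the named fact X keyed by the registered stub name. -/
abbrev stub_chiTwoPointFreeJordan : Prop := Literature.Probability.LatticeModels.chi_twoPoint_free_jordan

end Registered

/-! ### The composition: the two remaining stubs = the two PRINTED NAMED FACTS (rev 15: cdh16Thm11 = CDH16 Thm 1.1, chi = CHI15 Thm 1.1 free) ⇒ the crux BY NAME -/

/-- The repaired heart at `pt 0` from the open registered stubs of rev 8 (one-ball-component + two CDH16 instances +
CDH16 facts + FK heart, large-modulus path form) as hypotheses, through the LANDED large-modulus reductions, 1a, and
the LANDED Edwards–Sokal glue (rewrite the four two-point functions). -/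
theorem armOriginForgettingCore'_of (h4 : Registered.stub_chartDiscOneComponent)
    (h2 : Registered.stub_halfAnnulusSideCrossingBound) (h3 : Registered.stub_halfAnnulusRimCrossingBoundLarge)
    (hf : Registered.stub_cdh16) (hβ : Registered.stub_fkArmOriginForgettingPath) :
    ∀ (D : DobrushinDomain), ArmOriginForgettingAt' D.carrier (D.pt 0) := by
  intro D ε c η hε hc hη
  obtain ⟨r, hr, hev⟩ := hβ stub_chartAnnulusSeparation
    (roughHalfAnnulusRSWPathLarge_of_pathMeshLarge (roughHalfAnnulusRSWMeshLarge_of_bounds annSideCrossSeparation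
      h4 (h2 hf.1 hf.2.1) (h3 hf.1 hf.2.1 hf.2.2))) D ε c η hε hc hη
  refine ⟨r, hr, ?_⟩
  filter_upwards [hev] with δ hδ
  intro G₁ _ G₂ _ Λ₁ Λ₂ x x' y₁ y₂ hL₁ hL₂ hx₁ hx₂ hx'₁ hx'₂ hy₁ hy₂ hdx hdx' hdy₁ hdy₂ w₁ w₁' w₂ w₂'
  have key := hδ G₁ G₂ Λ₁ Λ₂ x x' y₁ y₂ hL₁ hL₂ hx₁ hx₂ hx'₁ hx'₂ hy₁ hy₂ hdx hdx' hdy₁ hdy₂ w₁ w₁' w₂ w₂'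
  simp only at key
  rw [stub_freeTwoPoint_eq_fkConn G₁ Λ₁ x y₁ hx₁ hy₁, stub_freeTwoPoint_eq_fkConn G₁ Λ₁ x' y₁ hx'₁ hy₁,
    stub_freeTwoPoint_eq_fkConn G₂ Λ₂ x y₂ hx₂ hy₂, stub_freeTwoPoint_eq_fkConn G₂ Λ₂ x' y₂ hx'₂ hy₂]
  exact key

/-- The rev-8 heart hypothesis from the rev-11 one: the mesh-local RSW forms are rebuilt from the open stubs exactly as in
`armOriginForgettingCore'_of`, clause (iii) is the LANDED stub `stub_halfAnnulusRadialCrossingBound` (rev 12). -/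
theorem fkArmOriginForgettingPath_of (h4 : Registered.stub_chartDiscOneComponent)
    (h2 : Registered.stub_halfAnnulusSideCrossingBound) (h3 : Registered.stub_halfAnnulusRimCrossingBoundLarge)
    (hf : Registered.stub_cdh16)
    (hβ : Registered.stub_fkArmOriginForgettingBS) : Registered.stub_fkArmOriginForgettingPath :=
  fun h1 hL => hβ h1 (roughHalfAnnulusRSWMeshLarge_of_bounds annSideCrossSeparation h4 (h2 hf.1 hf.2.1)
    (h3 hf.1 hf.2.1 hf.2.2)) stub_halfAnnulusRadialCrossingBound hL

/-- **`IsingBoundaryRatio_of`** (rev 6): chart-annulus separation (1a, landed) + the mesh RSW residual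
(1b″, path form) + the landed reductions + the REPAIRED arm-origin-forgetting heart at `pt 0` (1c' = Edwards–Sokal glue 1c'α + FK heart 1c'β) + reversal of Dobrushin
domains (1d, landed) + the repaired local-agreement transfer (1e') — together `AnchorLocality` — and the named fact
X = `chi_twoPoint_free_jordan` (CHI15 Thm 1.1 free) ⇒ `IsingBoundaryRatio`, through the LANDED
stubs (`bulkFreeRatio_of_chi` p91239, `stub_restrictionMapAtZero` p86712,
`stub_restrictionMapAtInfty` p88223, `stub_boundaryFusionCore` p87614), the proved
`anchorTransfer_of_anchorLocality` and `normalForm_of_transfer`, and the landed equivalence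
`isingBoundaryRatio_iff_normalForm` (crux ⟺ its `T`-normal form). -/
theorem IsingBoundaryRatio_of
    (hf : Registered.stub_cdh16Thm11)
    (hX : Registered.stub_chiTwoPointFreeJordan) : Theses.SAWLoopFugacityFlow.IsingBoundaryRatio :=
  have hW : Registered.stub_windowRectPresentation := stub_windowRectPresentation
  have h1cβ : Registered.stub_fkArmOriginForgettingBS := stub_fkArmOriginForgettingBS
  have hf3 : Registered.stub_cdh16 := ⟨hf, Literature.Probability.LatticeModels.discreteEL_ext_sandwich_holds,
    Literature.Probability.LatticeModels.discreteEL_ext_selfDual_holds⟩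
  have h2 : Registered.stub_halfAnnulusSideCrossingBound :=
    fun h1 h2 => halfAnnulusSideCrossingBound_of h1 h2 hW windowExtResistanceBound_holds
  have h3 : Registered.stub_halfAnnulusRimCrossingBoundLarge :=
    fun h1 h2 h3 => halfAnnulusRimCrossingBoundLarge_of' h1 h2 h3 hW windowExtResistanceBound_holds
      annCrossThroughWindowRect_holds
  isingBoundaryRatio_iff_normalForm.2
    (normalForm_of_transfer
      (anchorTransfer_of_anchorLocality
        (stub_localAgreementTransfer' (armOriginForgetting'_of_core
          (armOriginForgettingCore'_of Summit.CriticalPhenomena.SAWScalingLimit.Theorems.IsingBoundaryRatio.stub_chartDiscOneComponent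
            h2 h3 hf3
            (fkArmOriginForgettingPath_of
              Summit.CriticalPhenomena.SAWScalingLimit.Theorems.IsingBoundaryRatio.stub_chartDiscOneComponent h2 h3 hf3 h1cβ))
          stub_reverseDobrushin)))
      (Summit.CriticalPhenomena.SAWScalingLimit.Theorems.IsingBoundaryRatio.bulkFreeRatio_of_chi hX)
      (stub_boundaryFusionCore stub_restrictionMapAtZero
        (stub_restrictionMapAtInfty stub_restrictionMapAtZero)))

/-- Wiring check: the `sorry`'d stubs feed `IsingBoundaryRatio_of` as stated. -/
example : Theses.SAWLoopFugacityFlow.IsingBoundaryRatio :=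
  IsingBoundaryRatio_of stub_cdh16Thm11 stub_chiTwoPointFreeJordan


end Summit.CriticalPhenomena.SAWScalingLimit.Cruxes.IsingBoundaryRatio.FkAnchorTransfer

end
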